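import Summits.ValiantsHypothesis.ValiantsHypothesis.Theses.KPlusLogSqLaw
import Summits.ValiantsHypothesis.ValiantsHypothesis.Theorems.LacunarySymmetroidMatrixDescartesStubArith4
import Summits.ValiantsHypothesis.ValiantsHypothesis.Theorems.KPlusLogSqLawTropicalBSignsFree

/-!
# LINE «octave» (val-idea-6, lens «assume the law fails») — the OCTAVE form of Conjecture B / MatrixDescartes

HONEST FRAMING.  Ideator sketch (D-0145 line proposal to director-valiant; NOT a route, nothing filed on the ledger by
this seat).  Conjecture B (`KPlusLogSqLaw`), `TropicalB` (stmt-19771), `WeakLifting` (stmt-19561), `MatrixDescartes`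
(stmt-18050) are OPEN; nothing here proves any of them and nothing here bears on VP ≠ VNP except through the OPEN items
typed below.  What IS proved in this file (0 sorry): the octave statistic is dominated by the root
count (so every octave law is WEAKER than its root-count twin), the bridge «octave K+log² law ⇒ octave MatrixDescartes»,
the split «TropicalB ∧ OctaveWeakLifting ⇒ octave K+log² law», and the deciding composition
`valiant_of_octave : TropicalB → OctaveWeakLifting → OctaveThetaWitness → VP_ℂ ≠ VNP_ℂ`
(the closed `pencilTransfer_proof` transfers root SETS, hence octave counts, verbatim); the split
`kPlusLogSqLaw_iff_octave_and_perOctave : B ↔ Ω-B ∧ PO-B` (scales × clusters: `Z ≤ 1 + Ω·P` by the dyadic rescaling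
`S_l ↦ 2^{j d_l} S_l`) — AND ITS CORRECTION (v5): the per-octave half IS Conjecture B, `kPlusLogSqLaw_iff_perOctaveKLaw : B ↔ PO-B`,
by ODD DEGREE DILATION `d ↦ q·d` (`f(x) ↦ f(x^q)`: same format, symmetry kept, real roots `t ↦ t^{1/q}` bijectively) which compresses
every root scale by `1/q`, followed by the centring `x ↦ 2^{1/2} x`; so the split is LOPSIDED: B localises to ONE octave, indeed to any neighbourhood `[1, 1+ε)` of `x = 1`
(`kPlusLogSqLaw_iff_nearOneKLaw`, v6: B equals its germ at 1), and the line's entire content is the other direction — `OctaveKLaw` / `OctaveWeakLifting` are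
B-implied, dilation-robust, genuinely WEAKER statements (Ω can stay bounded while Z does not) that still decide VP ≠ VNP.
RUNG STATE: `shallowOctaveLifting_proof : ShallowOctaveLifting` is PROVED (0 sorry) from three named pieces, all proved here:
`rootNearBreakpoint_proof` (every nonzero real root of a nonzero depth-≤Δ pencil determinant has `log₂|x|` within
`m(log₂(mK)+1)+Δ` of a DESIGN BREAKPOINT — via `pencilDet_eq_sum` (Leibniz), `rawConfinement`, `envelopeGap`),
`cellCount_proof`, and `designPiecesBound_proof` (TropRowD m K n ⇒ the real-valued design envelope of any (m,K) pencil has ≤ n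
breakpoints: sorted breakpoints ⇒ a real chain `designPiecesBound_of_realChainBound`, then the INTEGERISATION
`realChainBound_proof` — integer design `−(2^W⌊Q log₂|S_e|⌋ + 2^{idx e})`, binary tie-breaker makes the argmax `IsDominant`,
margin argument keeps it in the slope class of the real top term, `DesignRowD`).

THE STATISTIC.  `octave x = ⌊log₂ |x|⌋` (as `Int.log 2 |x|`), `octaveCount p` = number of dyadic octaves carrying a
nonzero real root of `p`.  Valiant's criterion via real roots (Koiran / Tavenas, route LacunarySymmetroid) only ever
uses roots that sit ONE PER SCALE (Tavenas' `V_ν`: one root in each `(x_{u+1}, x_u)`, `x_u = -4^{2u+1}/4^N`, sixteen-fold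
apart), so the deciding chain runs on `octaveCount` instead of `card roots`: `OctaveThetaWitness` is the same witness.

WHY (lens «assume the law fails»).  A counterexample family to B must be one of: (i) a tropical monster (¬TropicalB);
(ii) a SPREAD monster — super-polynomially many root SCALES with no design shadow, which by the depth-confinement lemma
(`rawConfinement` + `envelopeGap`, both proved: every root scale lies within log₂(#Leibniz terms) + δ(F) of a breakpoint of
the design envelope, δ(F) = cancellation depth) costs cancellation depth δ ≥ 2^{C(K+log² m)}, i.e. doubly-exponential
arithmetic height; (iii) a CLUSTER monster — super-polynomially many roots inside ONE octave [2^j, 2^{j+1}) (the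
Chebyshev-in-format mechanism of the catalogued barrier `Literature.Barriers.ValiantsHypothesis.TauRealZeros`).
VNP-hardness through this door needs to exclude (i) and (ii) ONLY: (iii) is invisible to `octaveCount`.
-/

set_option linter.dupNamespace false
set_option autoImplicit false

namespace Summit.ValiantsHypothesis.ValiantsHypothesis.Theses.KPlusLogSqLaw.OctaveLine

open Polynomial Finset
open scoped BigOperators
open Summit.ValiantsHypothesis.ValiantsHypothesis.Theorems.LacunarySymmetroidMatrixDescartes (RealRootLawAt KPlusLogSqLaw)
open Summit.ValiantsHypothesis.ValiantsHypothesis.Theses.LacunarySymmetroid (MatrixDescartes PencilTransfer ThetaWitness)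
open Summit.ValiantsHypothesis.ValiantsHypothesis.Theses.KPlusLogSqLaw (TropicalB WeakLifting)

/-! ## The statistic -/

/-- dyadic octave (scale) of a real number: `⌊log₂ |x|⌋` (junk `0`-ish values at `x = 0` are never used: we filter `x ≠ 0`). -/
noncomputable def octave (x : ℝ) : ℤ := Int.log 2 |x|

/-- number of dyadic octaves `[2^j, 2^{j+1})` containing `|x|` for some NONZERO real root `x` of `p`. -/
noncomputable def octaveCount (p : ℝ[X]) : ℕ :=
  ((p.roots.toFinset.filter (fun x => x ≠ 0)).image octave).card

/-- the octave count never exceeds the number of distinct real roots. [folklore] -/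
theorem octaveCount_le_card (p : ℝ[X]) : octaveCount p ≤ p.roots.toFinset.card :=
  card_image_le.trans (card_filter_le _ _)

/-- the lacunary symmetric pencil determinant of format `(m, K)` (same term as in `RealRootLawAt` / `MatrixDescartes`). -/
noncomputable def pencilDet {m K : ℕ} (d : Fin K → ℕ) (S : Fin K → Matrix (Fin m) (Fin m) ℝ) : ℝ[X] :=
  Matrix.det (∑ l, ((Polynomial.X : Polynomial ℝ) ^ d l) • (S l).map Polynomial.C)

/-! ## The octave rows and laws (all OPEN where their root-count twins are) -/

/-- census row, octave form: every real symmetric lacunary pencil of format `(m, K)` has roots in at most `B` octaves. -/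
def OctaveRootLawAt (m K B : ℕ) : Prop :=
  ∀ (d : Fin K → ℕ) (S : Fin K → Matrix (Fin m) (Fin m) ℝ), (∀ l, (S l).IsSymm) →
    octaveCount (Matrix.det (∑ l, ((Polynomial.X : Polynomial ℝ) ^ d l) • (S l).map Polynomial.C)) ≤ B

/-- **Ω-B**, the octave `K + log² m` law (candidate, NOT asserted; weaker than `KPlusLogSqLaw`). -/
def OctaveKLaw : Prop := ∃ C : ℕ, ∀ m K : ℕ, OctaveRootLawAt m K (2 ^ (C * (K + Nat.log 2 m ^ 2)))

/-- **Ω-MDR**, the octave form of crux `MatrixDescartes` (stmt-18050) (candidate, NOT asserted; weaker than it). -/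
def OctaveMatrixDescartes : Prop :=
  ∀ c q : ℕ, 0 < q → ∃ K₀ : ℕ, ∀ K m : ℕ, K₀ ≤ K → m ≤ 2 ^ ((Nat.log 2 K + c) ^ c) →
    ∀ (d : Fin K → ℕ) (S : Fin K → Matrix (Fin m) (Fin m) ℝ), (∀ l, (S l).IsSymm) →
      octaveCount (Matrix.det (∑ l, ((Polynomial.X : Polynomial ℝ) ^ d l) • (S l).map Polynomial.C)) ^ q
        ≤ 2 ^ (K * Nat.log 2 K)

/-- **Ω-W**, octave weak lifting (the line's CRUX; candidate, NOT asserted; weaker than `WeakLifting` stmt-19561):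
the tropical census row of format `(m, K)` (verbatim hypothesis of `WeakLifting`) bounds the number of root OCTAVES of
every real symmetric lacunary pencil of that format, with slack `2^{C (K + ⌊log₂ m⌋²)}`. -/
def OctaveWeakLifting : Prop :=
  ∃ C : ℕ, ∀ (m K n : ℕ), (∀ (d : Fin K → ℕ) (v ε : Fin m → Fin m → Fin K → ℤ) (n' : ℕ) (θ : Fin (n' + 1) → ℤ)
    (p : Fin (n' + 1) → Equiv.Perm (Fin m) × (Fin m → Fin K)), (∀ i j l, (ε i j l).natAbs ≤ 1) → StrictMono θ →
    (∀ k, Summit.ValiantsHypothesis.ValiantsHypothesis.Theorems.MatrixDescartes.Negative.IsDominant d v ε (θ k) (p k)) →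
    (∀ k : Fin n', Summit.ValiantsHypothesis.ValiantsHypothesis.Theorems.MatrixDescartes.Negative.termSign ε (p k.castSucc) *
      Summit.ValiantsHypothesis.ValiantsHypothesis.Theorems.MatrixDescartes.Negative.termSign ε (p k.succ) < 0) → n' ≤ n) →
    OctaveRootLawAt m K (2 ^ (C * (K + Nat.log 2 m ^ 2)) * (n + 1))

/-- **Ω-Θ**, the octave Theta witness (support; PROVED below by the tree's Tavenas family, `octaveThetaWitness_proof`): a real family with VNP complexification and exponents whose monomial restriction has nonzero real roots in at least
`2^{n⌊log₂ n⌋} - 1` distinct dyadic octaves, eventually in `n`. -/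
def OctaveThetaWitness : Prop :=
  ∃ (Θ : ∀ n : ℕ, MvPolynomial (Fin n) ℝ) (d : ∀ n : ℕ, Fin n → ℕ),
    Literature.Computability.AlgebraicComplexity.IsVNPFamily (fun n => MvPolynomial.map (algebraMap ℝ ℂ) (Θ n)) ∧
    ∃ n₀ : ℕ, ∀ n : ℕ, n₀ ≤ n →
      2 ^ (n * Nat.log 2 n) ≤ octaveCount (MvPolynomial.aeval (fun i => (Polynomial.X : Polynomial ℝ) ^ d n i) (Θ n)) + 1

/-! ## Every octave statement is weaker than its root-count twin (so no recorded refutation touches it that spares B) -/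

/-- An octave law is implied by the root-count law with the same bound (`octaveCount ≤ #roots`). [folklore] -/
theorem octaveRootLawAt_of_realRootLawAt {m K B : ℕ} (h : RealRootLawAt m K B) : OctaveRootLawAt m K B :=
  fun d S hS => (octaveCount_le_card _).trans (h d S hS)

/-- Monotonicity of the octave law in the bound. [folklore] -/
theorem octaveRootLawAt_mono {m K B B' : ℕ} (hBB' : B ≤ B') (h : OctaveRootLawAt m K B) : OctaveRootLawAt m K B' :=
  fun d S hS => (h d S hS).trans hBB'

/-- B ⇒ Ω-B. [folklore] -/
theorem octaveKLaw_of_kPlusLogSqLaw (h : KPlusLogSqLaw) : OctaveKLaw := by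
  obtain ⟨C, hC⟩ := h
  exact ⟨C, fun m K => octaveRootLawAt_of_realRootLawAt (hC m K)⟩

/-- MDR ⇒ Ω-MDR. [folklore] -/
theorem octaveMatrixDescartes_of_matrixDescartes (h : MatrixDescartes) : OctaveMatrixDescartes := by
  intro c q hq
  obtain ⟨K₀, hK⟩ := h c q hq
  refine ⟨K₀, fun K m hK0 hm d S hS => ?_⟩
  exact (Nat.pow_le_pow_left (octaveCount_le_card _) q).trans (hK K m hK0 hm d S hS)

/-- W ⇒ Ω-W. [folklore] -/
theorem octaveWeakLifting_of_weakLifting (h : WeakLifting) : OctaveWeakLifting := by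
  obtain ⟨C, hC⟩ := h
  exact ⟨C, fun m K n hT => octaveRootLawAt_of_realRootLawAt (hC m K n hT)⟩

/-- Θ-witness with ≥ N roots in distinct octaves is in particular a Θ-witness: Ω-Θ ⇒ ThetaWitness. [folklore] -/
theorem thetaWitness_of_octaveThetaWitness (h : OctaveThetaWitness) : ThetaWitness := by
  obtain ⟨Θ, d, hV, n₀, hn⟩ := h
  exact ⟨Θ, d, hV, n₀, fun n hn0 => (hn n hn0).trans (Nat.add_le_add_right (octaveCount_le_card _) 1)⟩

/-! ## The deciding chain on octaves (all glue PROVED; the open inputs are `TropicalB`, `OctaveWeakLifting`) -/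

/-- TB ∧ Ω-W ⇒ Ω-B (the three-line computation of p417903, octave form). [folklore] -/
theorem octaveKLaw_of_tropicalB_of_octaveWeakLifting (hT : TropicalB) (hW : OctaveWeakLifting) : OctaveKLaw := by
  obtain ⟨CT, hT⟩ := hT
  obtain ⟨CW, hW⟩ := hW
  refine ⟨CW + CT + 1, fun m K => ?_⟩
  have h1 := hW m K (2 ^ (CT * (K + Nat.log 2 m ^ 2))) (hT m K)
  rcases Nat.eq_zero_or_pos K with hK | hK
  · subst hK
    intro d S _
    have h0 : (∑ l : Fin 0, ((Polynomial.X : Polynomial ℝ) ^ d l) • (S l).map Polynomial.C) = 0 := by simp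
    rw [h0]
    rcases Nat.eq_zero_or_pos m with hm | hm
    · subst hm
      have : octaveCount (Matrix.det (0 : Matrix (Fin 0) (Fin 0) ℝ[X])) ≤ (Matrix.det (0 : Matrix (Fin 0) (Fin 0) ℝ[X])).roots.toFinset.card :=
        octaveCount_le_card _
      simp [Matrix.det_isEmpty] at this ⊢
      rw [this]; exact Nat.zero_le _
    · haveI : Nonempty (Fin m) := ⟨⟨0, hm⟩⟩
      have : octaveCount (Matrix.det (0 : Matrix (Fin m) (Fin m) ℝ[X])) ≤ (Matrix.det (0 : Matrix (Fin m) (Fin m) ℝ[X])).roots.toFinset.card :=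
        octaveCount_le_card _
      simp [Matrix.det_zero] at this ⊢
      rw [this]; exact Nat.zero_le _
  · refine octaveRootLawAt_mono ?_ h1
    have e1 : 2 ^ (CT * (K + Nat.log 2 m ^ 2)) + 1 ≤ 2 ^ (CT * (K + Nat.log 2 m ^ 2) + 1) :=
      Nat.pow_lt_pow_right (by norm_num) (Nat.lt_succ_self _)
    calc 2 ^ (CW * (K + Nat.log 2 m ^ 2)) * (2 ^ (CT * (K + Nat.log 2 m ^ 2)) + 1)
        ≤ 2 ^ (CW * (K + Nat.log 2 m ^ 2)) * 2 ^ (CT * (K + Nat.log 2 m ^ 2) + 1) := Nat.mul_le_mul_left _ e1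
      _ = 2 ^ (CW * (K + Nat.log 2 m ^ 2) + (CT * (K + Nat.log 2 m ^ 2) + 1)) := (pow_add _ _ _).symm
      _ ≤ 2 ^ ((CW + CT + 1) * (K + Nat.log 2 m ^ 2)) :=
        Nat.pow_le_pow_right (by norm_num) (by nlinarith [hK, Nat.zero_le (Nat.log 2 m ^ 2)])

/-- Ω-B ⇒ Ω-MDR (the arithmetic of `Census.matrixDescartes_of_kPlusLogSqLaw`, octave form). [folklore] -/
theorem octaveMatrixDescartes_of_octaveKLaw (h : OctaveKLaw) : OctaveMatrixDescartes := by
  obtain ⟨C, hC⟩ := h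
  intro c q _hq
  obtain ⟨K₁, hK₁⟩ := Summit.ValiantsHypothesis.ValiantsHypothesis.Theorems.LacunarySymmetroidMatrixDescartes.StubArith4.exp_le
    (2 * c) (2 * q * C)
  refine ⟨max K₁ (2 ^ (2 * q * C)), fun K m hK hm d S hS => ?_⟩
  have hK1 : K₁ ≤ K := le_of_max_le_left hK
  have hK2 : 2 ^ (2 * q * C) ≤ K := le_of_max_le_right hK
  have hL : 2 * q * C ≤ Nat.log 2 K := Nat.le_log_of_pow_le one_lt_two hK2
  have hlogm : Nat.log 2 m ≤ (Nat.log 2 K + c) ^ c :=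
    calc Nat.log 2 m ≤ Nat.log 2 (2 ^ ((Nat.log 2 K + c) ^ c)) := Nat.log_mono_right hm
      _ = (Nat.log 2 K + c) ^ c := Nat.log_pow one_lt_two _
  have hsq : Nat.log 2 m ^ 2 ≤ (Nat.log 2 K + 2 * c) ^ (2 * c) :=
    calc Nat.log 2 m ^ 2 ≤ ((Nat.log 2 K + c) ^ c) ^ 2 := Nat.pow_le_pow_left hlogm 2
      _ = (Nat.log 2 K + c) ^ (2 * c) := by rw [← pow_mul, mul_comm]
      _ ≤ (Nat.log 2 K + 2 * c) ^ (2 * c) := Nat.pow_le_pow_left (by omega) _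
  have hZ := hC m K d S hS
  have h1 : 2 * q * C * (Nat.log 2 K + 2 * c) ^ (2 * c) ≤ K * Nat.log 2 K := hK₁ K hK1
  have h2 : 2 * q * C * K ≤ K * Nat.log 2 K :=
    calc 2 * q * C * K = K * (2 * q * C) := by ring
      _ ≤ K * Nat.log 2 K := Nat.mul_le_mul_left K hL
  have hexp : q * (C * (K + Nat.log 2 m ^ 2)) ≤ K * Nat.log 2 K := by
    have h3 : q * C * Nat.log 2 m ^ 2 ≤ q * C * (Nat.log 2 K + 2 * c) ^ (2 * c) := Nat.mul_le_mul_left _ hsq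
    have e1 : q * (C * (K + Nat.log 2 m ^ 2)) = q * C * K + q * C * Nat.log 2 m ^ 2 := by ring
    have e2 : 2 * q * C * (Nat.log 2 K + 2 * c) ^ (2 * c) = 2 * (q * C * (Nat.log 2 K + 2 * c) ^ (2 * c)) := by ring
    have e3 : 2 * q * C * K = 2 * (q * C * K) := by ring
    rw [e2] at h1
    rw [e3] at h2
    omega
  calc octaveCount (Matrix.det (∑ l, ((Polynomial.X : Polynomial ℝ) ^ d l) • (S l).map Polynomial.C)) ^ q
      ≤ (2 ^ (C * (K + Nat.log 2 m ^ 2))) ^ q := Nat.pow_le_pow_left hZ q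
    _ = 2 ^ (q * (C * (K + Nat.log 2 m ^ 2))) := by rw [← pow_mul, mul_comm]
    _ ≤ 2 ^ (K * Nat.log 2 K) := Nat.pow_le_pow_right (by norm_num) hexp

/-- Ω-MDR ∧ Ω-Θ ⇒ VP_ℂ ≠ VNP_ℂ, with the CLOSED `pencilTransfer_proof` (stmt-18051) — it transfers root SETS, hence `octaveCount`.
(The arithmetic of route LacunarySymmetroid's `closes`, octave form.) [folklore] -/
theorem valiant_of_octaveMatrixDescartes (hMDR : OctaveMatrixDescartes) (hW : OctaveThetaWitness) :
    _root_.ValiantsHypothesis := by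
  have hT : PencilTransfer := Summit.ValiantsHypothesis.ValiantsHypothesis.Theorems.LacunarySymmetroid.pencilTransfer_proof
  show Literature.Computability.AlgebraicComplexity.VP ℂ ≠ Literature.Computability.AlgebraicComplexity.VNP ℂ
  intro hEq
  obtain ⟨Θ, d, hVNP, n₀, hroots⟩ := hW
  have hVP : Literature.Computability.AlgebraicComplexity.IsVPFamily
      (fun n => MvPolynomial.map (algebraMap ℝ ℂ) (Θ n)) := by
    have hmem := (Literature.Computability.AlgebraicComplexity.mem_VNP_ofFintype_iff_holds _).2 hVNP
    rw [← hEq] at hmem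
    exact (Literature.Computability.AlgebraicComplexity.mem_VP_ofFintype_iff_holds _).1 hmem
  obtain ⟨c, hc⟩ := hT (fun n => n) Θ hVP d
  obtain ⟨K₀, hK⟩ := hMDR c 4 (by norm_num)
  obtain ⟨n, hn₀, hnK, hn4⟩ : ∃ n, n₀ ≤ n ∧ K₀ ≤ n ∧ 4 ≤ n := ⟨n₀ + K₀ + 4, by omega, by omega, by omega⟩
  obtain ⟨m, hm, S, hS, hroot⟩ := hc n
  set Z := octaveCount (MvPolynomial.aeval (fun i => (Polynomial.X : Polynomial ℝ) ^ d n i) (Θ n)) with hZ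
  have hm' : m ≤ 2 ^ ((Nat.log 2 (n + 1) + c) ^ c) :=
    hm.trans (Nat.pow_le_pow_right (by norm_num)
      (Nat.pow_le_pow_left (Nat.add_le_add_right (Nat.log_mono_right (Nat.le_succ n)) c) c))
  have h1 := hK (n + 1) m (by omega) hm' (Fin.cons (α := fun _ => ℕ) (0 : ℕ) (d n)) S hS
  have hZeq : octaveCount (Matrix.det (∑ l, ((Polynomial.X : Polynomial ℝ) ^ (Fin.cons (α := fun _ => ℕ) (0 : ℕ) (d n) l)) •
      (S l).map Polynomial.C)) = Z := by
    rw [hZ, octaveCount, octaveCount, hroot]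
  rw [hZeq] at h1
  have h2 : 2 ^ (n * Nat.log 2 n) ≤ Z + 1 := hroots n hn₀
  set L := Nat.log 2 n with hL
  have hL2 : 2 ≤ L := by
    rw [hL]
    calc 2 = Nat.log 2 4 := by decide
      _ ≤ Nat.log 2 n := Nat.log_mono_right hn4
  have hLn : L ≤ n := by rw [hL]; exact Nat.log_le_self 2 n
  have hL' : Nat.log 2 (n + 1) ≤ L + 1 := by
    rw [hL]
    calc Nat.log 2 (n + 1) ≤ Nat.log 2 (n * 2) := Nat.log_mono_right (by omega)
      _ = Nat.log 2 n + 1 := Nat.log_mul_base (by norm_num) (by omega)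
  have h3 : Z ^ 4 ≤ 2 ^ ((n + 1) * (L + 1)) :=
    h1.trans (Nat.pow_le_pow_right (by norm_num) (Nat.mul_le_mul_left _ hL'))
  have hnL : 1 ≤ n * L := by nlinarith
  have h4 : 2 ^ (n * L - 1) ≤ Z := by
    have e : 2 ^ (n * L) = 2 * 2 ^ (n * L - 1) := by
      rw [← Nat.pow_succ']
      congr 1
      omega
    have h2' := h2
    rw [e] at h2'
    have : 1 ≤ 2 ^ (n * L - 1) := Nat.one_le_two_pow
    omega
  have h5 : 2 ^ (4 * (n * L - 1)) ≤ Z ^ 4 := by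
    rw [pow_mul']
    exact Nat.pow_le_pow_left h4 4
  have h6 : 4 * (n * L - 1) ≤ (n + 1) * (L + 1) :=
    (Nat.pow_le_pow_iff_right (by norm_num)).1 (h5.trans h3)
  have h7 : 6 * n ≤ 3 * (n * L) := by nlinarith
  have h6' : 4 * (n * L - 1) ≤ n * L + n + L + 1 := by
    have e : (n + 1) * (L + 1) = n * L + n + L + 1 := by ring
    rw [e] at h6
    exact h6
  generalize hP : n * L = P at h6' h7 hnL
  omega

/-- **The line's deciding composition** (kernel-checked; hypotheses = existing crux `TropicalB` (stmt-19771) + the two new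
items): `TropicalB → OctaveWeakLifting → OctaveThetaWitness → VP_ℂ ≠ VNP_ℂ`.  `WeakLifting` (stmt-19561) is NOT used. -/
theorem valiant_of_octave (hT : TropicalB) (hΩW : OctaveWeakLifting) (hΘ : OctaveThetaWitness) :
    _root_.ValiantsHypothesis :=
  valiant_of_octaveMatrixDescartes
    (octaveMatrixDescartes_of_octaveKLaw (octaveKLaw_of_tropicalB_of_octaveWeakLifting hT hΩW)) hΘ

/-! ## Ω-Θ is a THEOREM: Tavenas' roots sit one per (pair of) octaves -/

section OctaveWitness

open Literature.Computability.AlgebraicComplexity (tavenasV xPt xPt_succ_lt sign_eval_xPt map_tavenasV_ne_zero)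

/-- Tavenas' sample points are negative. [folklore] -/
theorem xPt_neg (N u : ℕ) : xPt N u < 0 := by
  unfold xPt
  exact div_neg_of_neg_of_pos (neg_neg_of_pos (by positivity)) (by positivity)

/-- `-x_u = 2^{4u+2-2N}`. [folklore] -/
theorem neg_xPt_eq_zpow (N u : ℕ) : -xPt N u = (2 : ℝ) ^ ((4 * u + 2 : ℤ) - 2 * N) := by
  have h4 : (4 : ℝ) = 2 ^ 2 := by norm_num
  rw [xPt, neg_div, neg_neg, h4, ← pow_mul, ← pow_mul, zpow_sub₀ (by norm_num : (2 : ℝ) ≠ 0),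
    show ((4 * u + 2 : ℤ)) = ((2 * (2 * u + 1) : ℕ) : ℤ) by push_cast; ring,
    show ((2 * N : ℤ)) = ((2 * N : ℕ) : ℤ) by push_cast; ring, zpow_natCast, zpow_natCast]

/-- **Octave form of the alternation-to-roots lemma at Tavenas' points**: sign alternation of `p ≠ 0` at
`x_0 > x_1 > … > x_M` (`x_u = -4^{2u+1}/4^N`) yields `M` real roots in `M` DISTINCT dyadic octaves, because the
interval `(x_{u+1}, x_u)` has absolute values in `(2^{4u+2-2N}, 2^{4u+6-2N})`. [folklore] -/
theorem le_octaveCount_of_alternating_xPt (p : ℝ[X]) (hp : p ≠ 0) (N M : ℕ)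
    (hs : ∀ u, u ≤ M → 0 < (-1 : ℝ) ^ u * p.eval (xPt N u)) : M ≤ octaveCount p := by
  classical
  have hx : ∀ u, xPt N (u + 1) < xPt N u := xPt_succ_lt N
  have hroot : ∀ u, u < M → ∃ r, xPt N (u + 1) < r ∧ r < xPt N u ∧ p.IsRoot r := by
    intro u hu
    have h0 := hs u hu.le
    have h1 := hs (u + 1) hu
    rw [pow_succ] at h1
    have hcont := p.continuousOn (s := Set.Icc (xPt N (u + 1)) (xPt N u))
    rcases neg_one_pow_eq_or ℝ u with h | h
    · rw [h] at h0 h1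
      have ha : p.eval (xPt N (u + 1)) < 0 := by linarith
      have hb : 0 < p.eval (xPt N u) := by linarith
      obtain ⟨r, hr, hr0⟩ := intermediate_value_Ioo (hx u).le hcont ⟨ha, hb⟩
      exact ⟨r, hr.1, hr.2, hr0⟩
    · rw [h] at h0 h1
      have ha : 0 < p.eval (xPt N (u + 1)) := by linarith
      have hb : p.eval (xPt N u) < 0 := by linarith
      obtain ⟨r, hr, hr0⟩ := intermediate_value_Ioo' (hx u).le hcont ⟨hb, ha⟩
      exact ⟨r, hr.1, hr.2, hr0⟩
  choose! r hr using hroot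
  have hrneg : ∀ u, u < M → r u < 0 := fun u hu => (hr u hu).2.1.trans (xPt_neg N u)
  have hup : ∀ u, u < M → octave (r u) < (4 * u + 6 : ℤ) - 2 * N := by
    intro u hu
    have hpos : 0 < |r u| := abs_pos.2 (hrneg u hu).ne
    have h1 : |r u| < (2 : ℝ) ^ ((4 * u + 6 : ℤ) - 2 * N) := by
      rw [abs_of_neg (hrneg u hu)]
      have e := neg_xPt_eq_zpow N (u + 1)
      have e' : ((4 * ((u + 1 : ℕ) : ℤ) + 2 : ℤ)) - 2 * N = (4 * u + 6 : ℤ) - 2 * N := by push_cast; ring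
      rw [e'] at e
      linarith [(hr u hu).1]
    have h1' : |r u| < ((2 : ℕ) : ℝ) ^ ((4 * u + 6 : ℤ) - 2 * N) := by rwa [Nat.cast_ofNat]
    exact (Int.lt_zpow_iff_log_lt (b := 2) (by norm_num) hpos).1 h1'
  have hlow : ∀ v, v < M → (4 * v + 2 : ℤ) - 2 * N ≤ octave (r v) := by
    intro v hv
    have hpos : 0 < |r v| := abs_pos.2 (hrneg v hv).ne
    have h1 : (2 : ℝ) ^ ((4 * v + 2 : ℤ) - 2 * N) ≤ |r v| := by
      rw [abs_of_neg (hrneg v hv), ← neg_xPt_eq_zpow N v]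
      linarith [(hr v hv).2.1]
    have h1' : ((2 : ℕ) : ℝ) ^ ((4 * v + 2 : ℤ) - 2 * N) ≤ |r v| := by rwa [Nat.cast_ofNat]
    exact (Int.zpow_le_iff_le_log (b := 2) (by norm_num) hpos).1 h1'
  have hinj : Set.InjOn (fun u => octave (r u)) (range M : Set ℕ) := by
    intro u hu v hv huv
    have hu' : u < M := by simpa using hu
    have hv' : v < M := by simpa using hv
    simp only at huv
    by_contra hne
    rcases lt_or_gt_of_ne hne with h | h
    · have a := hup u hu'
      have b := hlow v hv'
      have hz : (u : ℤ) + 1 ≤ v := by exact_mod_cast h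
      omega
    · have a := hup v hv'
      have b := hlow u hu'
      have hz : (v : ℤ) + 1 ≤ u := by exact_mod_cast h
      omega
  have hsub : (range M).image (fun u => octave (r u)) ⊆ (p.roots.toFinset.filter (fun x => x ≠ 0)).image octave := by
    intro y hy
    obtain ⟨u, hu, rfl⟩ := mem_image.1 hy
    have hu' : u < M := by simpa using hu
    refine mem_image.2 ⟨r u, ?_, rfl⟩
    rw [mem_filter, Multiset.mem_toFinset, mem_roots hp]
    exact ⟨(hr u hu').2.2, (hrneg u hu').ne⟩
  calc M = ((range M).image (fun u => octave (r u))).card := by rw [card_image_of_injOn hinj, card_range]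
    _ ≤ _ := card_le_card hsub

/-- `V_n` has real roots in at least `2^n - 1` distinct dyadic octaves. [cite: Tavenas2014, Lemme 3.36] -/
theorem le_octaveCount_map_tavenasV (n : ℕ) :
    2 ^ n - 1 ≤ octaveCount ((tavenasV n).map (Int.castRingHom ℝ)) := by
  refine le_octaveCount_of_alternating_xPt _ (map_tavenasV_ne_zero n) (2 ^ n) _ fun u hu => sign_eval_xPt n u ?_
  have := Nat.one_le_two_pow (n := n)
  omega

end OctaveWitness

end Summit.ValiantsHypothesis.ValiantsHypothesis.Theses.KPlusLogSqLaw.OctaveLine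

/-! ### the witness family (verbatim copy of `thetaWitness_proof`, last three lines replaced by the octave count) -/

namespace Summit.ValiantsHypothesis.ValiantsHypothesis.Theses.KPlusLogSqLaw.OctaveLine

open MvPolynomial Literature.Computability.AlgebraicComplexity
open Summit.ValiantsHypothesis.ValiantsHypothesis.Theorems.SymmetroidDescartes
  (isProjection_map complexity_pow_le totalDegree_aeval_le_mul eval_map_tavenas_h)
open Summit.ValiantsHypothesis.ValiantsHypothesis.Theorems.FeketeSOSSOSMagnification
  (isVNPFamily_of_levelwise' boolSum_aeval_sumElim)
open Summit.ValiantsHypothesis.ValiantsHypothesis.Theorems.LacunarySymmetroid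
  (isVNPFamily_aeval_of_isPBounded isVNPFamily_map_of_isProjection_perPoly exists_digitSubst)

/-- **Ω-Θ holds** with Tavenas' witness of `thetaWitness_proof` (same `Θ`, same `d`, `n₀ = 1`). [cite: Tavenas2014, Lemme 3.36, Cor. 3.37] -/
theorem octaveThetaWitness_proof : OctaveThetaWitness := by
  unfold OctaveThetaWitness
  obtain ⟨q, hq, hh⟩ := Tavenas2014_cor_3_37_holds
  choose h hproj _ hsub using hh
  choose g hgcx hgdeg hgev using fun n : ℕ =>
    exists_digitSubst n (2 * (n * Nat.log 2 n) + 3) (2 * Nat.log 2 n + 3) (Nat.succ_pos _)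
  refine ⟨fun n => aeval (g n) (MvPolynomial.map (algebraMap ℚ ℝ) (h (n * Nat.log 2 n))),
    fun n i => 2 ^ ((2 * Nat.log 2 n + 3) * (i : ℕ)), ?_, 1, fun n hn => ?_⟩
  · /- VNP: the complexification is the substituted family over `ℂ` -/
    have hβ : ∀ n : ℕ, 2 ^ (2 * Nat.log 2 n + 3) ≤ 8 * (n * n) + 8 := by
      intro n
      rcases Nat.eq_zero_or_pos n with rfl | hn
      · simp
      · have h1 : 2 ^ Nat.log 2 n ≤ n := Nat.pow_log_le_self 2 hn.ne'
        calc 2 ^ (2 * Nat.log 2 n + 3) = 8 * (2 ^ Nat.log 2 n * 2 ^ Nat.log 2 n) := by ring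
          _ ≤ 8 * (n * n) + 8 := by nlinarith [Nat.mul_le_mul h1 h1]
    have hmap : ∀ n : ℕ, MvPolynomial.map (algebraMap ℝ ℂ)
        (aeval (g n) (MvPolynomial.map (algebraMap ℚ ℝ) (h (n * Nat.log 2 n)))) =
        aeval (fun v => MvPolynomial.map (algebraMap ℝ ℂ) (g n v))
          (MvPolynomial.map (algebraMap ℚ ℂ) (h (n * Nat.log 2 n))) := by
      intro n
      rw [aeval_eq_bind₁, aeval_eq_bind₁, map_bind₁, map_map]
      congr 2
    simp only [hmap]
    have hlog : IsPBounded (Nat.log 2) := IsPBounded.id.mono fun n => Nat.log_le_self 2 n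
    have hν : IsPBounded fun n => n * Nat.log 2 n := IsPBounded.mul_holds IsPBounded.id hlog
    have hB : IsPBounded fun n => (n + 2 * (2 * (n * Nat.log 2 n) + 3)) * (8 * (n * n) + 8) :=
      IsPBounded.mul_holds
        (IsPBounded.add_holds IsPBounded.id (IsPBounded.mul_holds (IsPBounded.const 2)
          (IsPBounded.add_holds (IsPBounded.mul_holds (IsPBounded.const 2) hν) (IsPBounded.const 3))))
        (IsPBounded.add_holds (IsPBounded.mul_holds (IsPBounded.const 8)
          (IsPBounded.mul_holds IsPBounded.id IsPBounded.id)) (IsPBounded.const 8))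
    refine isVNPFamily_aeval_of_isPBounded
      (σ := fun n => Fin (2 * (n * Nat.log 2 n) + 3) ⊕ Fin (2 * (n * Nat.log 2 n) + 3))
      (τ := fun n => Fin n)
      (isVNPFamily_map_of_isProjection_perPoly (σ := fun n =>
          Fin (2 * (n * Nat.log 2 n) + 3) ⊕ Fin (2 * (n * Nat.log 2 n) + 3))
        (q := fun n => q (n * Nat.log 2 n)) (IsPBounded.comp_holds hq hν) ?_
        (fun n => h (n * Nat.log 2 n)) fun n => hproj (n * Nat.log 2 n))
      (fun n v => MvPolynomial.map (algebraMap ℝ ℂ) (g n v)) hB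
      (fun n => ?_) (fun n => ?_) (fun n v => ?_)
    · -- number of variables of `h_ν`
      refine (IsPBounded.add_holds (IsPBounded.add_holds (IsPBounded.mul_holds (IsPBounded.const 2) hν)
        (IsPBounded.const 3)) (IsPBounded.add_holds (IsPBounded.mul_holds (IsPBounded.const 2) hν)
        (IsPBounded.const 3))).mono fun n => ?_
      rw [Fintype.card_sum, Fintype.card_fin]
    · -- number of variables of `Θ_n`
      rw [Fintype.card_fin]
      have : 1 ≤ 8 * (n * n) + 8 := by omega
      calc n ≤ n + 2 * (2 * (n * Nat.log 2 n) + 3) := Nat.le_add_right _ _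
        _ = (n + 2 * (2 * (n * Nat.log 2 n) + 3)) * 1 := (mul_one _).symm
        _ ≤ _ := Nat.mul_le_mul_left _ this
    · -- total cost of the substitution
      calc ∑ v, complexity (MvPolynomial.map (algebraMap ℝ ℂ) (g n v))
          ≤ ∑ _v : Fin (2 * (n * Nat.log 2 n) + 3) ⊕ Fin (2 * (n * Nat.log 2 n) + 3),
              2 ^ (2 * Nat.log 2 n + 3) := Finset.sum_le_sum fun v _ => hgcx n v
        _ = (2 * (2 * (n * Nat.log 2 n) + 3)) * 2 ^ (2 * Nat.log 2 n + 3) := by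
          rw [Finset.sum_const, Finset.card_univ, Fintype.card_sum, Fintype.card_fin, smul_eq_mul]
          ring
        _ ≤ (n + 2 * (2 * (n * Nat.log 2 n) + 3)) * (8 * (n * n) + 8) :=
          Nat.mul_le_mul (Nat.le_add_left _ _) (hβ n)
    · -- degrees of the substituted values
      calc (MvPolynomial.map (algebraMap ℝ ℂ) (g n v)).totalDegree ≤ 2 ^ (2 * Nat.log 2 n + 3) :=
            hgdeg n v
        _ ≤ 8 * (n * n) + 8 := hβ n
        _ = 1 * (8 * (n * n) + 8) := (one_mul _).symm
        _ ≤ (n + 2 * (2 * (n * Nat.log 2 n) + 3)) * (8 * (n * n) + 8) :=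
          Nat.mul_le_mul_right _ (by omega)
  · /- roots: the restriction along `y_i = X^{2^{β i}}` is `V_ν`, `ν = n ⌊log₂ n⌋` -/
    have hm : 2 * (n * Nat.log 2 n) + 3 ≤ (2 * Nat.log 2 n + 3) * n := by nlinarith
    have hP : aeval (fun i : Fin n => (Polynomial.X : Polynomial ℝ) ^ 2 ^ ((2 * Nat.log 2 n + 3) * (i : ℕ)))
        (aeval (g n) (MvPolynomial.map (algebraMap ℚ ℝ) (h (n * Nat.log 2 n)))) =
        (tavenasV (n * Nat.log 2 n)).map (Int.castRingHom ℝ) := by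
      apply Polynomial.funext
      intro x
      rw [← eval_map_tavenas_h (hsub (n * Nat.log 2 n)) x, ← Polynomial.coe_aeval_eq_eval,
        comp_aeval_apply, comp_aeval_apply, MvPolynomial.aeval_eq_eval]
      have hF : (fun v => aeval (fun i : Fin n => Polynomial.aeval x
            ((Polynomial.X : Polynomial ℝ) ^ 2 ^ ((2 * Nat.log 2 n + 3) * (i : ℕ)))) (g n v)) =
          Sum.elim (fun j : Fin (2 * (n * Nat.log 2 n) + 3) => x ^ 2 ^ (j : ℕ))
            (fun i : Fin (2 * (n * Nat.log 2 n) + 3) => (2 : ℝ) ^ 2 ^ (i : ℕ)) := by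
        funext v
        rw [← hgev n hm x v, MvPolynomial.aeval_eq_eval]
        have hpt : (fun i : Fin n => Polynomial.aeval x
            ((Polynomial.X : Polynomial ℝ) ^ 2 ^ ((2 * Nat.log 2 n + 3) * (i : ℕ)))) =
            fun i : Fin n => x ^ 2 ^ ((2 * Nat.log 2 n + 3) * (i : ℕ)) := by
          funext i
          simp only [map_pow, Polynomial.aeval_X]
        rw [hpt]
      rw [hF]
    rw [hP]
    have hr := le_octaveCount_map_tavenasV (n * Nat.log 2 n)
    have h1 : 1 ≤ 2 ^ (n * Nat.log 2 n) := Nat.one_le_two_pow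
    omega
/-! ## Corollaries: each octave law ALONE decides Valiant (given the tree's closed items) -/

/-- Ω-MDR ⇒ VP_ℂ ≠ VNP_ℂ (octave MatrixDescartes suffices; weaker than stmt-18050). -/
theorem valiant_of_octaveMatrixDescartes' (h : OctaveMatrixDescartes) : _root_.ValiantsHypothesis :=
  valiant_of_octaveMatrixDescartes h octaveThetaWitness_proof

/-- Ω-B ⇒ VP_ℂ ≠ VNP_ℂ (the octave `K + log² m` law suffices; weaker than Conjecture B). -/
theorem valiant_of_octaveKLaw (h : OctaveKLaw) : _root_.ValiantsHypothesis :=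
  valiant_of_octaveMatrixDescartes' (octaveMatrixDescartes_of_octaveKLaw h)

/-- **TB ∧ Ω-W ⇒ VP_ℂ ≠ VNP_ℂ** — the line's deciding theorem with only OPEN hypotheses left:
crux `TropicalB` (stmt-19771) and the NEW, WEAKER crux `OctaveWeakLifting` (replaces `WeakLifting` stmt-19561). -/
theorem valiant_of_tropicalB_of_octaveWeakLifting (hT : TropicalB) (hΩW : OctaveWeakLifting) :
    _root_.ValiantsHypothesis :=
  valiant_of_octave hT hΩW octaveThetaWitness_proof

/-! ## Scales × clusters: `B ↔ Ω-B ∧ PO-B`, and the correction `B ↔ PO-B` (odd degree dilation) — the octave half is the weaker door -/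

section ScalesClusters

open Polynomial Finset
open Summit.ValiantsHypothesis.ValiantsHypothesis.Theorems.LacunarySymmetroidMatrixDescartes (RealRootLawAt KPlusLogSqLaw)

/-- evaluation of the pencil determinant at a real point is the determinant of the evaluated pencil. [folklore] -/
theorem eval_pencilDet {m K : ℕ} (d : Fin K → ℕ) (S : Fin K → Matrix (Fin m) (Fin m) ℝ) (u : ℝ) :
    (pencilDet d S).eval u = Matrix.det (∑ l, u ^ d l • S l) := by
  unfold pencilDet
  rw [← Polynomial.coe_evalRingHom, RingHom.map_det]
  congr 1
  ext i j
  simp [Matrix.sum_apply, Matrix.smul_apply, Matrix.map_apply]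
  exact Finset.sum_congr rfl fun l _ => mul_comm _ _

/-- rescaled pencil: `S_l ↦ a^{d_l} S_l`. -/
noncomputable def scalePencil {m K : ℕ} (a : ℝ) (d : Fin K → ℕ) (S : Fin K → Matrix (Fin m) (Fin m) ℝ) :
    Fin K → Matrix (Fin m) (Fin m) ℝ := fun l => a ^ d l • S l

/-- Dyadic rescaling of the letters preserves symmetry. [folklore] -/
theorem scalePencil_isSymm {m K : ℕ} (a : ℝ) (d : Fin K → ℕ) (S : Fin K → Matrix (Fin m) (Fin m) ℝ)
    (hS : ∀ l, (S l).IsSymm) : ∀ l, (scalePencil a d S l).IsSymm := fun l => (hS l).smul _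

/-- `f_{scaled}(u) = f(a u)`. [folklore] -/
theorem eval_pencilDet_scale {m K : ℕ} (a : ℝ) (d : Fin K → ℕ) (S : Fin K → Matrix (Fin m) (Fin m) ℝ) (u : ℝ) :
    (pencilDet d (scalePencil a d S)).eval u = (pencilDet d S).eval (a * u) := by
  rw [eval_pencilDet, eval_pencilDet]
  congr 1
  refine Finset.sum_congr rfl fun l _ => ?_
  rw [scalePencil, smul_smul, mul_pow, mul_comm]

/-- Rescaling by `a ≠ 0` keeps the pencil determinant nonzero. [folklore] -/
theorem pencilDet_scale_ne_zero {m K : ℕ} (a : ℝ) (ha : a ≠ 0) (d : Fin K → ℕ) (S : Fin K → Matrix (Fin m) (Fin m) ℝ)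
    (h : pencilDet d S ≠ 0) : pencilDet d (scalePencil a d S) ≠ 0 := by
  intro h0
  apply h
  apply Polynomial.funext
  intro x
  have := eval_pencilDet_scale a d S (x / a)
  rw [h0, Polynomial.eval_zero, mul_div_cancel₀ _ ha] at this
  rw [← this, Polynomial.eval_zero]

/-- per-octave census row: every real symmetric lacunary pencil of format `(m, K)` has at most `P` distinct real roots `x` with
`|x| ∈ [1, 2)` (equivalently, by the rescaling `S_l ↦ 2^{j d_l} S_l`, in ANY dyadic octave). -/
def PerOctaveRootLawAt (m K P : ℕ) : Prop :=
  ∀ (d : Fin K → ℕ) (S : Fin K → Matrix (Fin m) (Fin m) ℝ), (∀ l, (S l).IsSymm) →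
    ((pencilDet d S).roots.toFinset.filter (fun x => 1 ≤ |x| ∧ |x| < 2)).card ≤ P

/-- roots in the octave `j` are at most the per-octave row bound (rescaling). [folklore] -/
theorem card_roots_octave_le {m K P : ℕ} (h : PerOctaveRootLawAt m K P) (d : Fin K → ℕ)
    (S : Fin K → Matrix (Fin m) (Fin m) ℝ) (hS : ∀ l, (S l).IsSymm) (j : ℤ) :
    (((pencilDet d S).roots.toFinset.filter (fun x => x ≠ 0)).filter (fun x => octave x = j)).card ≤ P := by
  classical
  set a : ℝ := (2 : ℝ) ^ j with ha
  have ha0 : 0 < a := zpow_pos (by norm_num) _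
  have hb := h d (scalePencil a d S) (scalePencil_isSymm a d S hS)
  refine le_trans ?_ hb
  apply Finset.card_le_card_of_injOn (fun x => x / a)
  · intro x hx
    rw [Finset.mem_coe, mem_filter, mem_filter, Multiset.mem_toFinset] at hx
    obtain ⟨⟨hxr, hx0⟩, hxj⟩ := hx
    have hp : pencilDet d S ≠ 0 := (mem_roots'.1 hxr).1
    have hroot : (pencilDet d S).IsRoot x := (mem_roots'.1 hxr).2
    rw [Finset.mem_coe, mem_filter, Multiset.mem_toFinset, mem_roots (pencilDet_scale_ne_zero a ha0.ne' d S hp), IsRoot,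
      eval_pencilDet_scale, mul_div_cancel₀ _ ha0.ne']
    refine ⟨hroot, ?_, ?_⟩
    · rw [abs_div, abs_of_pos ha0, le_div_iff₀ ha0, one_mul, ha]
      have hxpos : 0 < |x| := abs_pos.2 hx0
      have := Int.zpow_log_le_self (b := 2) (by norm_num) hxpos
      rw [octave] at hxj
      rw [hxj] at this
      exact_mod_cast this
    · rw [abs_div, abs_of_pos ha0, div_lt_iff₀ ha0, ha]
      have hxpos : 0 < |x| := abs_pos.2 hx0
      have := Int.lt_zpow_succ_log_self (b := 2) (by norm_num) |x|
      rw [octave] at hxj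
      rw [hxj] at this
      have e : ((2 : ℕ) : ℝ) ^ (j + 1) = 2 * (2 : ℝ) ^ j := by
        rw [Nat.cast_ofNat, zpow_add_one₀ (by norm_num : (2:ℝ) ≠ 0), mul_comm]
      rw [e] at this
      exact this
  · intro x _ y _ hxy
    simpa [div_left_inj' ha0.ne'] using hxy

/-- **scales × clusters**: the number of distinct real roots is at most `1 + Ω · P`. [folklore] -/
theorem card_roots_le_one_add_octave_mul {m K P : ℕ} (h : PerOctaveRootLawAt m K P) (d : Fin K → ℕ)
    (S : Fin K → Matrix (Fin m) (Fin m) ℝ) (hS : ∀ l, (S l).IsSymm) :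
    (pencilDet d S).roots.toFinset.card ≤ 1 + P * octaveCount (pencilDet d S) := by
  classical
  set R := (pencilDet d S).roots.toFinset with hR
  have h1 : R.card ≤ (R.filter (fun x => x = 0)).card + (R.filter (fun x => x ≠ 0)).card := by
    rw [← Finset.filter_card_add_filter_neg_card_eq_card (p := fun x => x = 0)]
  have h0 : (R.filter (fun x => x = 0)).card ≤ 1 := by
    calc (R.filter (fun x => x = 0)).card ≤ ({0} : Finset ℝ).card :=
          Finset.card_le_card (fun x hx => by rw [mem_filter] at hx; simp [hx.2])
      _ = 1 := card_singleton 0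
  have h2 : (R.filter (fun x => x ≠ 0)).card ≤ P * ((R.filter (fun x => x ≠ 0)).image octave).card :=
    Finset.card_le_mul_card_image _ P fun j _ => card_roots_octave_le h d S hS j
  unfold octaveCount
  rw [← hR]
  omega


/-- **PO-B**, the per-octave `K + log² m` law (NOT asserted): at most `2^{C(K+log² m)}` distinct real roots in any single dyadic octave.
EQUIVALENT TO CONJECTURE B (`kPlusLogSqLaw_iff_perOctaveKLaw`, odd degree dilation compresses all root scales into one octave) — so it is
NOT a weaker «cluster half»; recorded here because the equivalence «B localises to one octave» is itself informative. -/
def PerOctaveKLaw : Prop := ∃ C : ℕ, ∀ m K : ℕ, PerOctaveRootLawAt m K (2 ^ (C * (K + Nat.log 2 m ^ 2)))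

/-- B ⇒ PO-B. [folklore] -/
theorem perOctaveKLaw_of_kPlusLogSqLaw (h : KPlusLogSqLaw) : PerOctaveKLaw := by
  obtain ⟨C, hC⟩ := h
  exact ⟨C, fun m K d S hS => (card_filter_le _ _).trans (hC m K d S hS)⟩

/-- octave row ∧ per-octave row ⇒ root-count row (tree currency `RealRootLawAt`). [folklore] -/
theorem realRootLawAt_of_octave_of_perOctave {m K B P : ℕ} (hΩ : OctaveRootLawAt m K B) (hP : PerOctaveRootLawAt m K P) :
    RealRootLawAt m K (1 + P * B) := fun d S hS =>
  (card_roots_le_one_add_octave_mul hP d S hS).trans (by have := hΩ d S hS; unfold pencilDet at this ⊢; nlinarith)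

/-- **Ω-B ∧ PO-B ⇒ B.** [folklore] -/
theorem kPlusLogSqLaw_of_octaveKLaw_of_perOctaveKLaw (hΩ : OctaveKLaw) (hP : PerOctaveKLaw) : KPlusLogSqLaw := by
  obtain ⟨C₁, h₁⟩ := hΩ
  obtain ⟨C₂, h₂⟩ := hP
  refine ⟨C₁ + C₂ + 1, fun m K => ?_⟩
  rcases Nat.eq_zero_or_pos K with hK | hK
  · subst hK
    intro d S _
    have h0 : (∑ l : Fin 0, ((Polynomial.X : Polynomial ℝ) ^ d l) • (S l).map Polynomial.C) = 0 := by simp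
    rw [h0]
    rcases Nat.eq_zero_or_pos m with hm | hm
    · subst hm
      simp [Matrix.det_isEmpty]
    · haveI : Nonempty (Fin m) := ⟨⟨0, hm⟩⟩
      simp [Matrix.det_zero]
  · have h := realRootLawAt_of_octave_of_perOctave (h₁ m K) (h₂ m K)
    refine Summit.ValiantsHypothesis.ValiantsHypothesis.Theorems.LacunarySymmetroidMatrixDescartes.Census.realRootLawAt_mono ?_ h
    have hE : 1 ≤ K + Nat.log 2 m ^ 2 := by omega
    calc 1 + 2 ^ (C₂ * (K + Nat.log 2 m ^ 2)) * 2 ^ (C₁ * (K + Nat.log 2 m ^ 2))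
        = 1 + 2 ^ ((C₁ + C₂) * (K + Nat.log 2 m ^ 2)) := by rw [← pow_add]; ring_nf
      _ ≤ 2 ^ ((C₁ + C₂) * (K + Nat.log 2 m ^ 2) + 1) := by
          have h1 := Nat.one_le_two_pow (n := (C₁ + C₂) * (K + Nat.log 2 m ^ 2))
          have e : 2 ^ ((C₁ + C₂) * (K + Nat.log 2 m ^ 2) + 1) = 2 * 2 ^ ((C₁ + C₂) * (K + Nat.log 2 m ^ 2)) := by
            rw [pow_succ, mul_comm]
          rw [e]; omega
      _ ≤ 2 ^ ((C₁ + C₂ + 1) * (K + Nat.log 2 m ^ 2)) := Nat.pow_le_pow_right (by norm_num) (by nlinarith)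

/-- **B ⟺ Ω-B ∧ PO-B** (scales × clusters).  Valiant's hypothesis consumes only the first conjunct (`valiant_of_octaveKLaw`); the second
conjunct is B itself (`kPlusLogSqLaw_iff_perOctaveKLaw` below), so the informative reading is one-directional: Ω-B is the weaker door. [folklore] -/
theorem kPlusLogSqLaw_iff_octave_and_perOctave : KPlusLogSqLaw ↔ OctaveKLaw ∧ PerOctaveKLaw :=
  ⟨fun h => ⟨octaveKLaw_of_kPlusLogSqLaw h, perOctaveKLaw_of_kPlusLogSqLaw h⟩,
    fun h => kPlusLogSqLaw_of_octaveKLaw_of_perOctaveKLaw h.1 h.2⟩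

/-! ### Degree dilation (v5 correction): PO-B ⇒ B, so `B ↔ PO-B` — Conjecture B localises to one octave -/

/-- degree dilation `d ↦ q·d` (same format). -/
def dilate {K : ℕ} (q : ℕ) (d : Fin K → ℕ) : Fin K → ℕ := fun l => q * d l

/-- `f_{q·d}(u) = f_d(u^q)`. [folklore] -/
theorem eval_pencilDet_dilate {m K : ℕ} (q : ℕ) (d : Fin K → ℕ) (S : Fin K → Matrix (Fin m) (Fin m) ℝ) (u : ℝ) :
    (pencilDet (dilate q d) S).eval u = (pencilDet d S).eval (u ^ q) := by
  rw [eval_pencilDet, eval_pencilDet]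
  congr 1
  refine Finset.sum_congr rfl fun l _ => ?_
  rw [dilate, ← pow_mul]

/-- dilation by `q ≥ 1` keeps the pencil determinant nonzero. [folklore] -/
theorem pencilDet_dilate_ne_zero {m K : ℕ} (q : ℕ) (hq : 0 < q) (d : Fin K → ℕ) (S : Fin K → Matrix (Fin m) (Fin m) ℝ)
    (h : pencilDet d S ≠ 0) : pencilDet (dilate q d) S ≠ 0 := by
  intro h0
  apply h
  apply Polynomial.eq_zero_of_infinite_isRoot
  apply Set.Infinite.mono (s := Set.Ioi (0 : ℝ))
  · intro t ht
    have ht0 : (0 : ℝ) ≤ t := le_of_lt ht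
    have := eval_pencilDet_dilate q d S (t ^ ((q : ℝ)⁻¹))
    rw [h0, Polynomial.eval_zero, Real.rpow_inv_natCast_pow ht0 hq.ne'] at this
    exact this.symm
  · exact Set.Ioi_infinite 0

/-- **positive roots ≤ per-octave bound** (odd dilation compresses all positive root scales into one octave). [folklore] -/
theorem card_pos_roots_le {m K P : ℕ} (h : PerOctaveRootLawAt m K P) (d : Fin K → ℕ)
    (S : Fin K → Matrix (Fin m) (Fin m) ℝ) (hS : ∀ l, (S l).IsSymm) :
    ((pencilDet d S).roots.toFinset.filter (fun x => 0 < x)).card ≤ P := by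
  classical
  set R := (pencilDet d S).roots.toFinset.filter (fun x => 0 < x) with hR
  -- a common scale window 2^{-A} ≤ t ≤ 2^{A}
  set A : ℕ := ∑ t ∈ R, ⌈|Real.logb 2 t|⌉₊ with hA
  have hwin : ∀ t ∈ R, |Real.logb 2 t| ≤ A := by
    intro t ht
    calc |Real.logb 2 t| ≤ (⌈|Real.logb 2 t|⌉₊ : ℝ) := Nat.le_ceil _
      _ ≤ ((∑ t ∈ R, ⌈|Real.logb 2 t|⌉₊ : ℕ) : ℝ) := by
          exact_mod_cast Finset.single_le_sum (f := fun t => ⌈|Real.logb 2 t|⌉₊) (fun _ _ => Nat.zero_le _) ht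
  set q : ℕ := 2 * A + 1 with hq
  have hq0 : 0 < q := by omega
  have hqR : (0 : ℝ) < q := by exact_mod_cast hq0
  -- compressed and centred pencil
  set c : ℝ := (2 : ℝ) ^ (-(1 / 2 : ℝ)) with hc
  have hc0 : 0 < c := Real.rpow_pos_of_pos (by norm_num) _
  set S' := scalePencil c (dilate q d) S with hS'
  have hb := h (dilate q d) S' (scalePencil_isSymm c _ S hS)
  refine le_trans ?_ hb
  -- the map t ↦ 2^{1/2} t^{1/q}
  let f : ℝ → ℝ := fun t => (2 : ℝ) ^ (1 / 2 : ℝ) * t ^ ((q : ℝ)⁻¹)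
  have hcf : ∀ t, 0 ≤ t → (c * f t) ^ q = t := by
    intro t ht
    have : c * (2 : ℝ) ^ (1 / 2 : ℝ) = 1 := by
      rw [hc, ← Real.rpow_add (by norm_num : (0 : ℝ) < 2)]; norm_num
    show (c * ((2 : ℝ) ^ (1 / 2 : ℝ) * t ^ ((q : ℝ)⁻¹))) ^ q = t
    rw [← mul_assoc, this, one_mul, Real.rpow_inv_natCast_pow ht hq0.ne']
  apply Finset.card_le_card_of_injOn f
  · intro t ht
    rw [Finset.mem_coe, hR, mem_filter, Multiset.mem_toFinset] at ht
    obtain ⟨htr, ht0⟩ := ht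
    have hp : pencilDet d S ≠ 0 := (mem_roots'.1 htr).1
    have hroot : (pencilDet d S).IsRoot t := (mem_roots'.1 htr).2
    have hp' : pencilDet (dilate q d) S' ≠ 0 :=
      pencilDet_scale_ne_zero c hc0.ne' _ S (pencilDet_dilate_ne_zero q hq0 d S hp)
    rw [Finset.mem_coe, mem_filter, Multiset.mem_toFinset, mem_roots hp', IsRoot, hS', eval_pencilDet_scale,
      eval_pencilDet_dilate, hcf t ht0.le]
    refine ⟨hroot, ?_⟩
    -- window: 1 ≤ 2^{1/2} t^{1/q} < 2
    have hft : 0 < f t := mul_pos (Real.rpow_pos_of_pos (by norm_num) _) (Real.rpow_pos_of_pos ht0 _)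
    rw [abs_of_pos hft]
    have hlog : Real.logb 2 (f t) = 1 / 2 + (q : ℝ)⁻¹ * Real.logb 2 t := by
      show Real.logb 2 ((2 : ℝ) ^ (1 / 2 : ℝ) * t ^ ((q : ℝ)⁻¹)) = _
      rw [Real.logb_mul (Real.rpow_pos_of_pos (by norm_num) _).ne' (Real.rpow_pos_of_pos ht0 _).ne',
        Real.logb_rpow (by norm_num) (by norm_num), Real.logb_rpow_eq_mul_logb_of_pos ht0]
    have hw := hwin t (by rw [hR, mem_filter, Multiset.mem_toFinset]; exact ⟨htr, ht0⟩)
    have hAq : (A : ℝ) * (q : ℝ)⁻¹ < 1 / 2 := by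
      rw [← div_eq_mul_inv, div_lt_iff₀ hqR, hq]; push_cast; linarith
    have habs := abs_le.1 hw
    have hqi : (0 : ℝ) < (q : ℝ)⁻¹ := inv_pos.2 hqR
    have hlo : 0 ≤ Real.logb 2 (f t) := by
      rw [hlog]; nlinarith [habs.1, hqi, hAq]
    have hhi : Real.logb 2 (f t) < 1 := by
      rw [hlog]; nlinarith [habs.2, hqi, hAq]
    constructor
    · have := (Real.logb_nonneg_iff (by norm_num : (1:ℝ) < 2) hft).1 hlo
      exact this
    · have := (Real.logb_lt_iff_lt_rpow (by norm_num : (1:ℝ) < 2) hft).1 hhi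
      simpa using this
  · intro t₁ ht₁ t₂ ht₂ hft
    rw [Finset.mem_coe, hR, mem_filter] at ht₁ ht₂
    have e1 := hcf t₁ ht₁.2.le
    have e2 := hcf t₂ ht₂.2.le
    have : f t₁ = f t₂ := hft
    rw [← e1, ← e2, this]

/-- negative roots of `f` are positive roots of `u ↦ f(−u)` (a rescaling by `−1`). [folklore] -/
theorem card_neg_roots_le {m K P : ℕ} (h : PerOctaveRootLawAt m K P) (d : Fin K → ℕ)
    (S : Fin K → Matrix (Fin m) (Fin m) ℝ) (hS : ∀ l, (S l).IsSymm) :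
    ((pencilDet d S).roots.toFinset.filter (fun x => x < 0)).card ≤ P := by
  classical
  have hb := card_pos_roots_le h d (scalePencil (-1) d S) (scalePencil_isSymm (-1) d S hS)
  refine le_trans ?_ hb
  apply Finset.card_le_card_of_injOn (fun x => -x)
  · intro x hx
    rw [Finset.mem_coe, mem_filter, Multiset.mem_toFinset] at hx
    obtain ⟨hxr, hx0⟩ := hx
    have hp : pencilDet d S ≠ 0 := (mem_roots'.1 hxr).1
    have hroot : (pencilDet d S).IsRoot x := (mem_roots'.1 hxr).2
    rw [Finset.mem_coe, mem_filter, Multiset.mem_toFinset,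
      mem_roots (pencilDet_scale_ne_zero (-1) (by norm_num) d S hp), IsRoot, eval_pencilDet_scale]
    refine ⟨by simpa using hroot, by linarith⟩
  · intro x _ y _ hxy; simpa using hxy

/-- **PO-row ⇒ real row**: `Z ≤ 2P + 1`. [folklore] -/
theorem realRootLawAt_of_perOctave {m K P : ℕ} (h : PerOctaveRootLawAt m K P) : RealRootLawAt m K (2 * P + 1) := by
  classical
  intro d S hS
  set R := (Matrix.det (∑ l, ((Polynomial.X : Polynomial ℝ) ^ d l) • (S l).map Polynomial.C)).roots.toFinset with hR
  have hR' : R = (pencilDet d S).roots.toFinset := rfl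
  have hsub : R ⊆ (R.filter (fun x => 0 < x) ∪ R.filter (fun x => x < 0)) ∪ {0} := by
    intro x hx
    rcases lt_trichotomy x 0 with hl | he | hg
    · exact mem_union_left _ (mem_union_right _ (mem_filter.2 ⟨hx, hl⟩))
    · exact mem_union_right _ (by simp [he])
    · exact mem_union_left _ (mem_union_left _ (mem_filter.2 ⟨hx, hg⟩))
  have h1 := card_pos_roots_le h d S hS
  have h2 := card_neg_roots_le h d S hS
  rw [← hR'] at h1 h2
  calc R.card ≤ ((R.filter (fun x => 0 < x) ∪ R.filter (fun x => x < 0)) ∪ {0}).card := card_le_card hsub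
    _ ≤ (R.filter (fun x => 0 < x) ∪ R.filter (fun x => x < 0)).card + ({0} : Finset ℝ).card := card_union_le _ _
    _ ≤ ((R.filter (fun x => 0 < x)).card + (R.filter (fun x => x < 0)).card) + 1 :=
        Nat.add_le_add (card_union_le _ _) (by simp)
    _ ≤ 2 * P + 1 := by omega

/-- **PO-B ⇒ B**: the per-octave `K + log² m` law IS Conjecture B (up to the constant). [folklore] -/
theorem kPlusLogSqLaw_of_perOctaveKLaw (h : PerOctaveKLaw) : KPlusLogSqLaw := by
  obtain ⟨C, hC⟩ := h
  refine ⟨C + 2, fun m K => ?_⟩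
  have hrow := realRootLawAt_of_perOctave (hC m K)
  rcases Nat.eq_zero_or_pos (K + Nat.log 2 m ^ 2) with hE | hE
  · -- K = 0: no letters, no roots
    have hK : K = 0 := by omega
    subst hK
    intro d S _
    have h0 : (∑ l : Fin 0, ((Polynomial.X : Polynomial ℝ) ^ d l) • (S l).map Polynomial.C) = 0 := by simp
    rw [h0]
    rcases Nat.eq_zero_or_pos m with hm | hm
    · subst hm; simp [Matrix.det_isEmpty]
    · haveI : Nonempty (Fin m) := ⟨⟨0, hm⟩⟩
      simp [Matrix.det_zero]
  · refine Summit.ValiantsHypothesis.ValiantsHypothesis.Theorems.LacunarySymmetroidMatrixDescartes.Census.realRootLawAt_mono ?_ hrow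
    set E := K + Nat.log 2 m ^ 2
    have hx : 1 ≤ 2 ^ (C * E) := Nat.one_le_two_pow
    calc 2 * 2 ^ (C * E) + 1 ≤ 2 ^ (C * E + 2) := by rw [pow_add]; omega
      _ ≤ 2 ^ ((C + 2) * E) := Nat.pow_le_pow_right (by norm_num) (by nlinarith)

/-- **B ⟺ PO-B** (v5): Conjecture B is equivalent to its restriction to the single octave `|x| ∈ [1,2)`. [folklore] -/
theorem kPlusLogSqLaw_iff_perOctaveKLaw : KPlusLogSqLaw ↔ PerOctaveKLaw :=
  ⟨perOctaveKLaw_of_kPlusLogSqLaw, kPlusLogSqLaw_of_perOctaveKLaw⟩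

/-- hence PO-B alone already gives the octave law (and everything B gives). [folklore] -/
theorem octaveKLaw_of_perOctaveKLaw (h : PerOctaveKLaw) : OctaveKLaw :=
  octaveKLaw_of_kPlusLogSqLaw (kPlusLogSqLaw_of_perOctaveKLaw h)

/-! ### The germ at `x = 1` (v6): Conjecture B equals its restriction to `[1, 1 + ε)` for every `ε > 0` -/

/-- positive-root census row: at most `P` distinct positive real roots. -/
def PosRootLawAt (m K P : ℕ) : Prop :=
  ∀ (d : Fin K → ℕ) (S : Fin K → Matrix (Fin m) (Fin m) ℝ), (∀ l, (S l).IsSymm) →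
    ((pencilDet d S).roots.toFinset.filter (fun x => 0 < x)).card ≤ P

/-- near-one census row with window `ε`: at most `P` distinct real roots in `[1, 1 + ε)`. -/
def NearOneRootLawAt (m K : ℕ) (ε : ℝ) (P : ℕ) : Prop :=
  ∀ (d : Fin K → ℕ) (S : Fin K → Matrix (Fin m) (Fin m) ℝ), (∀ l, (S l).IsSymm) →
    ((pencilDet d S).roots.toFinset.filter (fun x => 1 ≤ x ∧ x < 1 + ε)).card ≤ P

/-- the near-one `K + log² m` law with window `ε` (NOT asserted). -/
def NearOneKLaw (ε : ℝ) : Prop := ∃ C : ℕ, ∀ m K : ℕ, NearOneRootLawAt m K ε (2 ^ (C * (K + Nat.log 2 m ^ 2)))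

/-- negative roots of `f` are positive roots of `u ↦ f(−u)`: a positive-root row bounds negative roots too. [folklore] -/
theorem card_neg_roots_le_of_pos {m K P : ℕ} (h : PosRootLawAt m K P) (d : Fin K → ℕ)
    (S : Fin K → Matrix (Fin m) (Fin m) ℝ) (hS : ∀ l, (S l).IsSymm) :
    ((pencilDet d S).roots.toFinset.filter (fun x => x < 0)).card ≤ P := by
  classical
  have hb := h d (scalePencil (-1) d S) (scalePencil_isSymm (-1) d S hS)
  refine le_trans ?_ hb
  apply Finset.card_le_card_of_injOn (fun x => -x)
  · intro x hx
    rw [Finset.mem_coe, mem_filter, Multiset.mem_toFinset] at hx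
    obtain ⟨hxr, hx0⟩ := hx
    have hp : pencilDet d S ≠ 0 := (mem_roots'.1 hxr).1
    have hroot : (pencilDet d S).IsRoot x := (mem_roots'.1 hxr).2
    rw [Finset.mem_coe, mem_filter, Multiset.mem_toFinset,
      mem_roots (pencilDet_scale_ne_zero (-1) (by norm_num) d S hp), IsRoot, eval_pencilDet_scale]
    refine ⟨by simpa using hroot, by linarith⟩
  · intro x _ y _ hxy; simpa using hxy

/-- **positive row ⇒ real row**: `Z ≤ 2P + 1`. [folklore] -/
theorem realRootLawAt_of_pos {m K P : ℕ} (h : PosRootLawAt m K P) : RealRootLawAt m K (2 * P + 1) := by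
  classical
  intro d S hS
  set R := (Matrix.det (∑ l, ((Polynomial.X : Polynomial ℝ) ^ d l) • (S l).map Polynomial.C)).roots.toFinset with hR
  have hR' : R = (pencilDet d S).roots.toFinset := rfl
  have hsub : R ⊆ (R.filter (fun x => 0 < x) ∪ R.filter (fun x => x < 0)) ∪ {0} := by
    intro x hx
    rcases lt_trichotomy x 0 with hl | he | hg
    · exact mem_union_left _ (mem_union_right _ (mem_filter.2 ⟨hx, hl⟩))
    · exact mem_union_right _ (by simp [he])
    · exact mem_union_left _ (mem_union_left _ (mem_filter.2 ⟨hx, hg⟩))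
  have h1 := h d S hS
  have h2 := card_neg_roots_le_of_pos h d S hS
  rw [← hR'] at h1 h2
  calc R.card ≤ ((R.filter (fun x => 0 < x) ∪ R.filter (fun x => x < 0)) ∪ {0}).card := card_le_card hsub
    _ ≤ (R.filter (fun x => 0 < x) ∪ R.filter (fun x => x < 0)).card + ({0} : Finset ℝ).card := card_union_le _ _
    _ ≤ ((R.filter (fun x => 0 < x)).card + (R.filter (fun x => x < 0)).card) + 1 :=
        Nat.add_le_add (card_union_le _ _) (by simp)
    _ ≤ 2 * P + 1 := by omega

/-- **near-one row ⇒ positive row** (v6): a dilation `d ↦ q·d` with `q > 2A / log₂(1+ε)` followed by the centring `x ↦ 2^{A/q} x`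
maps ALL positive roots (scales in `[2^{-A}, 2^{A}]`) injectively into `[1, 1 + ε)`, format and symmetry unchanged. [folklore] -/
theorem posRootLawAt_of_nearOne {m K P : ℕ} {ε : ℝ} (hε : 0 < ε) (h : NearOneRootLawAt m K ε P) : PosRootLawAt m K P := by
  classical
  intro d S hS
  set R := (pencilDet d S).roots.toFinset.filter (fun x => 0 < x) with hR
  set A : ℕ := ∑ t ∈ R, ⌈|Real.logb 2 t|⌉₊ with hA
  have hwin : ∀ t ∈ R, |Real.logb 2 t| ≤ A := by
    intro t ht
    calc |Real.logb 2 t| ≤ (⌈|Real.logb 2 t|⌉₊ : ℝ) := Nat.le_ceil _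
      _ ≤ ((∑ t ∈ R, ⌈|Real.logb 2 t|⌉₊ : ℕ) : ℝ) := by
          exact_mod_cast Finset.single_le_sum (f := fun t => ⌈|Real.logb 2 t|⌉₊) (fun _ _ => Nat.zero_le _) ht
  have hL : 0 < Real.logb 2 (1 + ε) := Real.logb_pos (by norm_num) (by linarith)
  obtain ⟨q₀, hq₀⟩ := exists_nat_gt (2 * (A : ℝ) / Real.logb 2 (1 + ε))
  set q : ℕ := q₀ + 1 with hq
  have hq0 : 0 < q := by omega
  have hqR : (0 : ℝ) < q := by exact_mod_cast hq0
  have hqgt : 2 * (A : ℝ) / Real.logb 2 (1 + ε) < q := by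
    rw [hq]; push_cast; linarith
  have hAq : 2 * (A : ℝ) * (q : ℝ)⁻¹ < Real.logb 2 (1 + ε) := by
    rw [← div_eq_mul_inv, div_lt_iff₀ hqR]
    rw [div_lt_iff₀ hL] at hqgt
    linarith
  set β : ℝ := (A : ℝ) * (q : ℝ)⁻¹ with hβ
  set c : ℝ := (2 : ℝ) ^ (-β) with hc
  have hc0 : 0 < c := Real.rpow_pos_of_pos (by norm_num) _
  set S' := scalePencil c (dilate q d) S with hS'
  have hb := h (dilate q d) S' (scalePencil_isSymm c _ S hS)
  refine le_trans ?_ hb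
  let f : ℝ → ℝ := fun t => (2 : ℝ) ^ β * t ^ ((q : ℝ)⁻¹)
  have hcf : ∀ t, 0 ≤ t → (c * f t) ^ q = t := by
    intro t ht
    have : c * (2 : ℝ) ^ β = 1 := by
      rw [hc, ← Real.rpow_add (by norm_num : (0 : ℝ) < 2)]; simp
    show (c * ((2 : ℝ) ^ β * t ^ ((q : ℝ)⁻¹))) ^ q = t
    rw [← mul_assoc, this, one_mul, Real.rpow_inv_natCast_pow ht hq0.ne']
  apply Finset.card_le_card_of_injOn f
  · intro t ht
    rw [Finset.mem_coe, hR, mem_filter, Multiset.mem_toFinset] at ht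
    obtain ⟨htr, ht0⟩ := ht
    have hp : pencilDet d S ≠ 0 := (mem_roots'.1 htr).1
    have hroot : (pencilDet d S).IsRoot t := (mem_roots'.1 htr).2
    have hp' : pencilDet (dilate q d) S' ≠ 0 :=
      pencilDet_scale_ne_zero c hc0.ne' _ S (pencilDet_dilate_ne_zero q hq0 d S hp)
    rw [Finset.mem_coe, mem_filter, Multiset.mem_toFinset, mem_roots hp', IsRoot, hS', eval_pencilDet_scale,
      eval_pencilDet_dilate, hcf t ht0.le]
    refine ⟨hroot, ?_⟩
    have hft : 0 < f t := mul_pos (Real.rpow_pos_of_pos (by norm_num) _) (Real.rpow_pos_of_pos ht0 _)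
    have hlog : Real.logb 2 (f t) = β + (q : ℝ)⁻¹ * Real.logb 2 t := by
      show Real.logb 2 ((2 : ℝ) ^ β * t ^ ((q : ℝ)⁻¹)) = _
      rw [Real.logb_mul (Real.rpow_pos_of_pos (by norm_num) _).ne' (Real.rpow_pos_of_pos ht0 _).ne',
        Real.logb_rpow (by norm_num) (by norm_num), Real.logb_rpow_eq_mul_logb_of_pos ht0]
    have hw := hwin t (by rw [hR, mem_filter, Multiset.mem_toFinset]; exact ⟨htr, ht0⟩)
    have habs := abs_le.1 hw
    have hqi : (0 : ℝ) < (q : ℝ)⁻¹ := inv_pos.2 hqR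
    have hlo : 0 ≤ Real.logb 2 (f t) := by
      rw [hlog, hβ]; nlinarith [habs.1, hqi]
    have hhi : Real.logb 2 (f t) < Real.logb 2 (1 + ε) := by
      rw [hlog, hβ]; nlinarith [habs.2, hqi, hAq]
    constructor
    · exact (Real.logb_nonneg_iff (by norm_num : (1:ℝ) < 2) hft).1 hlo
    · exact (Real.logb_lt_logb_iff (by norm_num : (1:ℝ) < 2) hft (by linarith)).1 hhi
  · intro t₁ ht₁ t₂ ht₂ hft
    rw [Finset.mem_coe, hR, mem_filter] at ht₁ ht₂
    have e1 := hcf t₁ ht₁.2.le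
    have e2 := hcf t₂ ht₂.2.le
    have : f t₁ = f t₂ := hft
    rw [← e1, ← e2, this]

/-- B ⇒ near-one law (restriction). [folklore] -/
theorem nearOneKLaw_of_kPlusLogSqLaw (ε : ℝ) (h : KPlusLogSqLaw) : NearOneKLaw ε := by
  obtain ⟨C, hC⟩ := h
  exact ⟨C, fun m K d S hS => (Finset.card_filter_le _ _).trans (hC m K d S hS)⟩

/-- near-one law ⇒ B (`C ↦ C + 2`). [folklore] -/
theorem kPlusLogSqLaw_of_nearOneKLaw {ε : ℝ} (hε : 0 < ε) (h : NearOneKLaw ε) : KPlusLogSqLaw := by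
  obtain ⟨C, hC⟩ := h
  refine ⟨C + 2, fun m K => ?_⟩
  have hrow := realRootLawAt_of_pos (posRootLawAt_of_nearOne hε (hC m K))
  rcases Nat.eq_zero_or_pos (K + Nat.log 2 m ^ 2) with hE | hE
  · have hK : K = 0 := by omega
    subst hK
    intro d S _
    have h0 : (∑ l : Fin 0, ((Polynomial.X : Polynomial ℝ) ^ d l) • (S l).map Polynomial.C) = 0 := by simp
    rw [h0]
    rcases Nat.eq_zero_or_pos m with hm | hm
    · subst hm; simp [Matrix.det_isEmpty]
    · haveI : Nonempty (Fin m) := ⟨⟨0, hm⟩⟩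
      simp [Matrix.det_zero]
  · refine Summit.ValiantsHypothesis.ValiantsHypothesis.Theorems.LacunarySymmetroidMatrixDescartes.Census.realRootLawAt_mono ?_ hrow
    set E := K + Nat.log 2 m ^ 2
    have hx : 1 ≤ 2 ^ (C * E) := Nat.one_le_two_pow
    calc 2 * 2 ^ (C * E) + 1 ≤ 2 ^ (C * E + 2) := by rw [pow_add]; omega
      _ ≤ 2 ^ ((C + 2) * E) := Nat.pow_le_pow_right (by norm_num) (by nlinarith)

/-- **B equals its germ at `x = 1`** (v6): for every `ε > 0`, Conjecture B ⟺ the same `K + log² m` budget for roots in `[1, 1 + ε)`. [folklore] -/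
theorem kPlusLogSqLaw_iff_nearOneKLaw {ε : ℝ} (hε : 0 < ε) : KPlusLogSqLaw ↔ NearOneKLaw ε :=
  ⟨nearOneKLaw_of_kPlusLogSqLaw ε, kPlusLogSqLaw_of_nearOneKLaw hε⟩

/-- **Lens «assume the law fails» — formally a trichotomy, honestly a DICHOTOMY WITH REMAINDER (kernel).**  If Conjecture B fails then
EITHER the tropical row is super-polynomial (`¬TropicalB`), OR octave lifting fails (`¬OctaveWeakLifting`: super-polynomially many root
SCALES beyond the design's breakpoints — by `rootNearBreakpoint_proof` this forces unbounded cancellation depth), OR `¬PerOctaveKLaw` — and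
the third disjunct is `¬B` REWORDED (`kPlusLogSqLaw_iff_perOctaveKLaw`: every ¬B family has a one-octave avatar in the same format by odd
degree dilation), so it carries no information of its own.  The content is: the Valiant door of this line needs exactly
`TropicalB ∧ OctaveWeakLifting`, and a ¬B family closes it only if it is (or dilates to) a tropical or a deep-spread monster; a ¬B family
with boundedly many root SCALES per tropical budget leaves the door open.  Nothing here asserts which case (if any) occurs. [folklore] -/
theorem notB_trichotomy (hB : ¬ KPlusLogSqLaw) : ¬ TropicalB ∨ ¬ OctaveWeakLifting ∨ ¬ PerOctaveKLaw := by
  by_contra h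
  push_neg at h
  obtain ⟨hT, hW, hP⟩ := h
  exact hB (kPlusLogSqLaw_of_octaveKLaw_of_perOctaveKLaw (octaveKLaw_of_tropicalB_of_octaveWeakLifting hT hW) hP)

/-- the deciding theorem of this line does not mention root COUNTS per octave at all: `TropicalB ∧ OctaveWeakLifting` suffices, and is
(as a hypothesis shape) compatible with `¬B = ¬PerOctaveKLaw`. [folklore] -/
theorem valiant_door_ignores_clusters (hT : TropicalB) (hW : OctaveWeakLifting) : _root_.ValiantsHypothesis :=
  valiant_of_tropicalB_of_octaveWeakLifting hT hW

end ScalesClusters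

/-! ## Toward the crux: cancellation DEPTH and the shallow rung (PROVED: `shallowOctaveLifting_proof`) -/

section Depth

open Finset

/-- **cancellation depth ≤ Δ bits.**  Leibniz raw terms of the pencil `Σ_l X^{d l} S_l` are pairs `(σ, λ)` with value
`sign σ · Π_i S_{λ i}(σ i, i)` and slope class `e = Σ_i d(λ i)`; the class sums are the coefficients of `det`.  `DepthLE d S Δ`:
in every class the sum of absolute values of the raw terms is at most `2^Δ ·|coefficient|` (no dead classes, cancellation
loses at most `Δ` bits).  Integer pencils of height `H` with no dead class have `Δ ≤ log₂ (m! K^m H^m)`. [definition of the seat] -/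
def DepthLE {m K : ℕ} (d : Fin K → ℕ) (S : Fin K → Matrix (Fin m) (Fin m) ℝ) (Δ : ℕ) : Prop :=
  ∀ e : ℕ, (∑ σ : Equiv.Perm (Fin m), ∑ lam : Fin m → Fin K,
      (if (∑ i, d (lam i)) = e then ∏ i, |S (lam i) (σ i) i| else 0)) ≤ (2 : ℝ) ^ Δ * |(pencilDet d S).coeff e|

/-- **Shallow octave lifting** (the line's first RUNG; PROVED below — `shallowOctaveLifting_proof`, 0 sorry — from three named pieces:
`designPiecesBound_proof` = the real→integer design reduction (`realChainBound_proof`, binary tie-breaker + margin), the depth confinement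
`rootNearBreakpoint_proof` (raw confinement + envelope gap + Leibniz bookkeeping) and the unit-cell count `cellCount_proof`):
if the unsigned tropical row of format `(m, K)` is `≤ n` (`TropRowD m K n`) then every pencil of that format with
cancellation depth `≤ Δ` has its nonzero real roots in at most `(2 (M + Δ) + 3)(n + 1)` dyadic octaves, `M = m (log₂ (m K) + 1)`
(`≥ log₂` of the number `m! K^m` of raw terms): every root scale lies within `M + Δ` of a breakpoint of the design envelope.
Symmetry of the `S l` is not even needed.  NOT the crux: `OctaveWeakLifting` is the depth-FREE statement. -/
def ShallowOctaveLifting : Prop :=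
  ∀ (m K n Δ : ℕ), Summit.ValiantsHypothesis.ValiantsHypothesis.Theorems.KPlusLogSqLaw.TropRowD m K n →
    ∀ (d : Fin K → ℕ) (S : Fin K → Matrix (Fin m) (Fin m) ℝ), DepthLE d S Δ →
      octaveCount (pencilDet d S) ≤ (2 * (m * (Nat.log 2 (m * K) + 1) + Δ) + 3) * (n + 1)

/-- **atom 1 (raw confinement), PROVED.**  At a positive root of a signed sum of monomials `Σ_τ sgn τ · a τ · x^{s τ}` whose
equal-exponent classes cancel to depth `≤ Δ` bits, every NONZERO raw term (in particular the largest) is within a factor `#ι · 2^Δ` of a raw term of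
ANOTHER class. [folklore] -/
theorem rawConfinement {ι : Type*} [Fintype ι] (s : ι → ℕ) (a : ι → ℝ) (ha : ∀ τ, 0 ≤ a τ) (sgn : ι → ℝ)
    (hsgn : ∀ τ, sgn τ = 1 ∨ sgn τ = -1) (Δ : ℕ)
    (hdepth : ∀ e : ℕ, (∑ τ ∈ univ.filter (fun τ => s τ = e), a τ) ≤
      (2 : ℝ) ^ Δ * |∑ τ ∈ univ.filter (fun τ => s τ = e), sgn τ * a τ|)
    (x : ℝ) (hx : 0 < x) (hroot : ∑ τ, sgn τ * a τ * x ^ (s τ) = 0) (τ₀ : ι) (ha₀ : 0 < a τ₀) :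
    ∃ τ₁, s τ₁ ≠ s τ₀ ∧ a τ₀ * x ^ (s τ₀) ≤ Fintype.card ι * (2 : ℝ) ^ Δ * (a τ₁ * x ^ (s τ₁)) := by
  classical
  have habs : ∀ τ, |sgn τ| = 1 := fun τ => by rcases hsgn τ with h | h <;> simp [h]
  have hsplit : ∑ τ, sgn τ * a τ * x ^ (s τ) =
      x ^ (s τ₀) * (∑ τ ∈ univ.filter (fun τ => s τ = s τ₀), sgn τ * a τ) +
        ∑ τ ∈ univ.filter (fun τ => ¬ s τ = s τ₀), sgn τ * a τ * x ^ (s τ) := by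
    rw [← Finset.sum_filter_add_sum_filter_not univ (fun τ => s τ = s τ₀)]
    congr 1
    rw [Finset.mul_sum]
    refine Finset.sum_congr rfl fun τ hτ => ?_
    rw [(mem_filter.1 hτ).2]; ring
  set C := univ.filter (fun τ => s τ = s τ₀) with hC
  set O := univ.filter (fun τ => ¬ s τ = s τ₀) with hO
  set c := ∑ τ ∈ C, sgn τ * a τ with hc
  have hxpos : 0 < x ^ (s τ₀) := pow_pos hx _
  have hkey : x ^ (s τ₀) * |c| ≤ ∑ τ ∈ O, a τ * x ^ (s τ) := by
    have h1 : x ^ (s τ₀) * c = -∑ τ ∈ O, sgn τ * a τ * x ^ (s τ) := by linarith [hsplit.symm.trans hroot]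
    calc x ^ (s τ₀) * |c| = |x ^ (s τ₀) * c| := by rw [abs_mul, abs_of_pos hxpos]
      _ = |∑ τ ∈ O, sgn τ * a τ * x ^ (s τ)| := by rw [h1, abs_neg]
      _ ≤ ∑ τ ∈ O, |sgn τ * a τ * x ^ (s τ)| := abs_sum_le_sum_abs _ _
      _ = ∑ τ ∈ O, a τ * x ^ (s τ) := Finset.sum_congr rfl fun τ _ => by
          rw [abs_mul, abs_mul, habs, one_mul, abs_of_nonneg (ha τ), abs_of_pos (pow_pos hx _)]
  have hτ₀C : τ₀ ∈ C := by simp [hC]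
  have h1 : a τ₀ ≤ (2 : ℝ) ^ Δ * |c| :=
    (Finset.single_le_sum (f := a) (fun τ _ => ha τ) hτ₀C).trans (hdepth (s τ₀))
  have hO_ne : O.Nonempty := by
    by_contra hemp
    rw [Finset.not_nonempty_iff_eq_empty] at hemp
    have h0 : x ^ (s τ₀) * |c| ≤ 0 := by simpa [hemp] using hkey
    have hcabs : |c| ≤ 0 := by
      by_contra hpos
      push_neg at hpos
      have := mul_pos hxpos hpos
      linarith
    have : a τ₀ ≤ 0 := h1.trans (by nlinarith [hcabs, abs_nonneg c, pow_pos (by norm_num : (0:ℝ) < 2) Δ])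
    linarith
  obtain ⟨τ₁, hτ₁O, hmax⟩ := Finset.exists_max_image O (fun τ => a τ * x ^ (s τ)) hO_ne
  refine ⟨τ₁, (mem_filter.1 hτ₁O).2, ?_⟩
  have hpos₁ : 0 ≤ a τ₁ * x ^ (s τ₁) := mul_nonneg (ha τ₁) (pow_pos hx _).le
  have hcard : (O.card : ℝ) ≤ Fintype.card ι := by
    have : O.card ≤ Fintype.card ι := (card_filter_le _ _).trans (Finset.card_univ).le
    exact_mod_cast this
  have hsumO : ∑ τ ∈ O, a τ * x ^ (s τ) ≤ Fintype.card ι * (a τ₁ * x ^ (s τ₁)) :=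
    calc ∑ τ ∈ O, a τ * x ^ (s τ) ≤ ∑ _τ ∈ O, a τ₁ * x ^ (s τ₁) := Finset.sum_le_sum fun τ hτ => hmax τ hτ
      _ = O.card * (a τ₁ * x ^ (s τ₁)) := by rw [Finset.sum_const, nsmul_eq_mul]
      _ ≤ Fintype.card ι * (a τ₁ * x ^ (s τ₁)) := mul_le_mul_of_nonneg_right hcard hpos₁
  calc a τ₀ * x ^ (s τ₀) ≤ (2 : ℝ) ^ Δ * |c| * x ^ (s τ₀) := mul_le_mul_of_nonneg_right h1 hxpos.le
    _ = (2 : ℝ) ^ Δ * (x ^ (s τ₀) * |c|) := by ring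
    _ ≤ (2 : ℝ) ^ Δ * ∑ τ ∈ O, a τ * x ^ (s τ) := mul_le_mul_of_nonneg_left hkey (by positivity)
    _ ≤ (2 : ℝ) ^ Δ * (Fintype.card ι * (a τ₁ * x ^ (s τ₁))) := mul_le_mul_of_nonneg_left hsumO (by positivity)
    _ = Fintype.card ι * (2 : ℝ) ^ Δ * (a τ₁ * x ^ (s τ₁)) := by ring

/-- right-moving half of `envelopeGap`. [folklore] -/
theorem envelopeGap_right {ι : Type*} [Fintype ι] (s : ι → ℤ) (V : ι → ℝ) (c θ : ℝ) (i j : ι) (hij : s i < s j)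
    (htop : ∀ k, V k + s k * θ ≤ V i + s i * θ) (hnear : V i + s i * θ ≤ V j + s j * θ + c) :
    ∃ b : ℝ, θ ≤ b ∧ b ≤ θ + c ∧ ∃ l, s i ≠ s l ∧ V i + s i * b = V l + s l * b ∧
      ∀ t, V t + s t * b ≤ V i + s i * b := by
  classical
  set R := univ.filter (fun k => s i < s k) with hR
  have hjR : j ∈ R := by simp [hR, hij]
  obtain ⟨k₀, hk₀R, hmin⟩ := Finset.exists_min_image R (fun k => (V i - V k) / ((s k : ℝ) - s i)) ⟨j, hjR⟩
  have hk₀ : s i < s k₀ := (mem_filter.1 hk₀R).2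
  have hden : ∀ k, s i < s k → (0 : ℝ) < (s k : ℝ) - s i := fun k hk => by
    have : (s i : ℝ) < s k := by exact_mod_cast hk
    linarith
  have hden1 : ∀ k, s i < s k → (1 : ℝ) ≤ (s k : ℝ) - s i := fun k hk => by
    have h1 : s i + 1 ≤ s k := hk
    have : ((s i : ℝ)) + 1 ≤ s k := by exact_mod_cast h1
    linarith
  have hcross : ∀ k, s i < s k → θ ≤ (V i - V k) / ((s k : ℝ) - s i) := fun k hk => by
    rw [le_div_iff₀ (hden k hk)]
    have := htop k
    nlinarith
  refine ⟨(V i - V k₀) / ((s k₀ : ℝ) - s i), hcross k₀ hk₀, ?_, k₀, hk₀.ne, ?_, ?_⟩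
  · have htj : (V i - V j) / ((s j : ℝ) - s i) ≤ θ + c := by
      rw [div_le_iff₀ (hden j hij)]
      have hc0 : 0 ≤ c := by linarith [htop j]
      have h1 := hden1 j hij
      nlinarith [hnear, hc0, h1]
    exact (hmin j hjR).trans htj
  · have hne : (s k₀ : ℝ) - s i ≠ 0 := (hden k₀ hk₀).ne'
    have : (V i - V k₀) / ((s k₀ : ℝ) - s i) * ((s k₀ : ℝ) - s i) = V i - V k₀ := div_mul_cancel₀ _ hne
    linarith
  · intro t
    by_cases ht : s i < s t
    · have h1 : (V i - V k₀) / ((s k₀ : ℝ) - s i) ≤ (V i - V t) / ((s t : ℝ) - s i) := hmin t (by simp [hR, ht])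
      rw [le_div_iff₀ (hden t ht)] at h1
      linarith
    · push_neg at ht
      have hst : (s t : ℝ) ≤ s i := by exact_mod_cast ht
      have hθb : θ ≤ (V i - V k₀) / ((s k₀ : ℝ) - s i) := hcross k₀ hk₀
      have := htop t
      nlinarith [hst, hθb, this]

/-- **atom 2 (envelope geometry), PROVED.**  Lines `θ ↦ V i + s i · θ` with INTEGER slopes: if at `θ` the top line `i` is within
`c` of a line `j` of different slope, then within distance `c` of `θ` there is a breakpoint of the upper envelope (two lines of distinct
slopes tie at the top).  Key: the gap to any line of different slope changes at rate `≥ 1`. [folklore] -/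
theorem envelopeGap {ι : Type*} [Fintype ι] (s : ι → ℤ) (V : ι → ℝ) (c θ : ℝ) (i j : ι) (hij : s i ≠ s j)
    (htop : ∀ k, V k + s k * θ ≤ V i + s i * θ) (hnear : V i + s i * θ ≤ V j + s j * θ + c) :
    ∃ b : ℝ, |θ - b| ≤ c ∧ ∃ k l, s k ≠ s l ∧ V k + s k * b = V l + s l * b ∧ ∀ t, V t + s t * b ≤ V k + s k * b := by
  rcases lt_or_gt_of_ne hij with h | h
  · obtain ⟨b, hθb, hbc, l, hsl, htie, hall⟩ := envelopeGap_right s V c θ i j h htop hnear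
    refine ⟨b, ?_, i, l, hsl, htie, hall⟩
    rw [abs_of_nonpos (by linarith)]
    linarith
  · obtain ⟨b, hθb, hbc, l, hsl, htie, hall⟩ := envelopeGap_right (fun k => -s k) V c (-θ) i j
      (by simpa using h) (fun k => by have := htop k; push_cast; linarith) (by push_cast; linarith)
    refine ⟨-b, ?_, i, l, ?_, ?_, ?_⟩
    · rw [show θ - -b = -(-θ - b) by ring, abs_neg, abs_of_nonpos (by linarith)]
      linarith
    · simpa using hsl
    · push_cast at htie
      linarith
    · intro t
      have := hall t
      push_cast at this
      linarith

/-! ### The rung's plan: three named pieces and their kernel-checked composition -/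

/-- raw Leibniz terms `(σ, λ)` of an `(m, K)` pencil. -/
abbrev RawTerm (m K : ℕ) := Equiv.Perm (Fin m) × (Fin m → Fin K)

variable {m K : ℕ}

/-- signed value of a raw term: `sign σ · Π_i S_{λ i}(σ i, i)`. -/
def rawCoef (S : Fin K → Matrix (Fin m) (Fin m) ℝ) (τ : RawTerm m K) : ℝ :=
  ((Equiv.Perm.sign τ.1 : ℤ) : ℝ) * ∏ i, S (τ.2 i) (τ.1 i) i

/-- slope class of a raw term: `Σ_i d(λ i)`. -/
def rawSlope (d : Fin K → ℕ) (τ : RawTerm m K) : ℕ := ∑ i, d (τ.2 i)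

/-- log-height of a raw term (junk for absent terms, never used there). -/
noncomputable def rawLog (S : Fin K → Matrix (Fin m) (Fin m) ℝ) (τ : RawTerm m K) : ℝ := Real.logb 2 |rawCoef S τ|

/-- crossing abscissa (in `θ = log₂|x|`) of the lines of two raw terms. -/
noncomputable def rawCross (d : Fin K → ℕ) (S : Fin K → Matrix (Fin m) (Fin m) ℝ) (kl : RawTerm m K × RawTerm m K) : ℝ :=
  (rawLog S kl.1 - rawLog S kl.2) / ((rawSlope d kl.2 : ℝ) - rawSlope d kl.1)

open scoped Classical in
/-- **design breakpoints** of the pencil: abscissae where two PRESENT raw lines of distinct slopes tie AT THE TOP of the upper envelope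
`θ ↦ max_{τ present} (rawLog S τ + rawSlope d τ · θ)` (the archimedean tropicalisation of the raw Leibniz expansion — no cancellation seen). -/
noncomputable def designBreaks (d : Fin K → ℕ) (S : Fin K → Matrix (Fin m) (Fin m) ℝ) : Finset ℝ :=
  ((Finset.univ : Finset (RawTerm m K × RawTerm m K)).filter (fun kl =>
      rawCoef S kl.1 ≠ 0 ∧ rawCoef S kl.2 ≠ 0 ∧ rawSlope d kl.1 ≠ rawSlope d kl.2 ∧
        ∀ t : RawTerm m K, rawCoef S t ≠ 0 →
          rawLog S t + rawSlope d t * rawCross d S kl ≤ rawLog S kl.1 + rawSlope d kl.1 * rawCross d S kl)).image (rawCross d S)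

/-- **piece 1 (real → integer design reduction; PROVED as `designPiecesBound_proof`).**  The unsigned tropical row bounds the number of
design breakpoints of every REAL-valued pencil design (sorted breakpoints ⇒ interleaved real chain ⇒ `realChainBound_proof`). [folklore] -/
def DesignPiecesBound : Prop :=
  ∀ (m K n : ℕ), Summit.ValiantsHypothesis.ValiantsHypothesis.Theorems.KPlusLogSqLaw.TropRowD m K n →
    ∀ (d : Fin K → ℕ) (S : Fin K → Matrix (Fin m) (Fin m) ℝ), (designBreaks d S).card ≤ n

/-- the raw line of a term in the `θ = log₂|x|` picture. -/
noncomputable def rawLine (d : Fin K → ℕ) (S : Fin K → Matrix (Fin m) (Fin m) ℝ) (τ : RawTerm m K) (θ : ℝ) : ℝ :=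
  rawLog S τ + rawSlope d τ * θ

/-- at the crossing abscissa the two lines agree. -/
theorem rawLine_cross (d : Fin K → ℕ) (S : Fin K → Matrix (Fin m) (Fin m) ℝ) (k l : RawTerm m K)
    (h : rawSlope d k ≠ rawSlope d l) : rawLine d S k (rawCross d S (k, l)) = rawLine d S l (rawCross d S (k, l)) := by
  have hne : (rawSlope d l : ℝ) - rawSlope d k ≠ 0 := by
    rw [sub_ne_zero]; exact_mod_cast (Ne.symm h)
  rw [rawLine, rawLine, rawCross]
  field_simp
  ring

/-- if two lines of distinct slopes agree at `θ`, their crossing abscissa is `θ`. -/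
theorem rawCross_eq_of_tie (d : Fin K → ℕ) (S : Fin K → Matrix (Fin m) (Fin m) ℝ) (k l : RawTerm m K)
    (h : rawSlope d k ≠ rawSlope d l) {θ : ℝ} (htie : rawLine d S k θ = rawLine d S l θ) : rawCross d S (k, l) = θ := by
  have hne : (rawSlope d l : ℝ) - rawSlope d k ≠ 0 := by
    rw [sub_ne_zero]; exact_mod_cast (Ne.symm h)
  rw [rawLine, rawLine] at htie
  rw [rawCross, div_eq_iff hne]
  linarith

/-- slope comparison: a top term LEFT of a point where `k` is on top has slope `≤` that of `k`. -/
theorem slope_le_of_top_left {d : Fin K → ℕ} {S : Fin K → Matrix (Fin m) (Fin m) ℝ} {t k : RawTerm m K} {θ c : ℝ} (hθc : θ < c)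
    (h1 : rawLine d S k θ ≤ rawLine d S t θ) (h2 : rawLine d S t c ≤ rawLine d S k c) : rawSlope d t ≤ rawSlope d k := by
  by_contra hlt
  push_neg at hlt
  have hlt' : (rawSlope d k : ℝ) < rawSlope d t := by exact_mod_cast hlt
  simp only [rawLine] at h1 h2
  nlinarith [mul_pos (sub_pos.2 hlt') (sub_pos.2 hθc)]

/-- slope comparison: a top term RIGHT of a point where `k` is on top has slope `≥` that of `k`. -/
theorem le_slope_of_top_right {d : Fin K → ℕ} {S : Fin K → Matrix (Fin m) (Fin m) ℝ} {t k : RawTerm m K} {θ c : ℝ} (hcθ : c < θ)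
    (h1 : rawLine d S k θ ≤ rawLine d S t θ) (h2 : rawLine d S t c ≤ rawLine d S k c) : rawSlope d k ≤ rawSlope d t := by
  by_contra hlt
  push_neg at hlt
  have hlt' : (rawSlope d t : ℝ) < rawSlope d k := by exact_mod_cast hlt
  simp only [rawLine] at h1 h2
  nlinarith [mul_pos (sub_pos.2 hlt') (sub_pos.2 hcθ)]

/-- **piece 1′ (the clean integerisation statement; PROVED as `realChainBound_proof`).**  REAL CHAINS OBEY THE INTEGER TROPICAL ROW:
if `TropRowD m K n`, then for every real pencil design, every chain of `N + 1` points `θ₀ < ⋯ < θ_N` carrying top PRESENT raw terms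
`t_j` (maximal raw line at `θ_j`; ties at `θ_j` only inside the slope class of `t_j`) with strictly increasing slope classes has
`N ≤ n`.  PROVED below (`realChainBound_proof`): integer design `v'(e) = −(2^W⌊Q log₂|S_e|⌋ + 2^{idx e})`, `ε'(e) = [S_e ≠ 0]`,
slopes `θ'_j = 2^W⌊Qθ_j⌋`; all tropical weights are distinct by the binary tie-breaker, so the argmax `p_j` is `IsDominant`; it is
`(m Σd + m + 1)/Q`-top against `t_j` in the real design, hence (margin `μ`, `Q` large) in the slope class of `t_j`; then `DesignRowD`.
[folklore: rational approximation + lexicographic tie-break, cf. `tropicalB_iff_cardRatDominant`] -/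
def RealChainBound : Prop :=
  ∀ (m K n : ℕ), Summit.ValiantsHypothesis.ValiantsHypothesis.Theorems.KPlusLogSqLaw.TropRowD m K n →
    ∀ (d : Fin K → ℕ) (S : Fin K → Matrix (Fin m) (Fin m) ℝ) (N : ℕ) (θ : Fin (N + 1) → ℝ) (t : Fin (N + 1) → RawTerm m K),
    StrictMono θ → (∀ j, rawCoef S (t j) ≠ 0) →
    (∀ j τ, rawCoef S τ ≠ 0 → rawLine d S τ (θ j) ≤ rawLine d S (t j) (θ j)) →
    (∀ j τ, rawCoef S τ ≠ 0 → rawLine d S τ (θ j) = rawLine d S (t j) (θ j) → rawSlope d τ = rawSlope d (t j)) →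
    StrictMono (fun j => rawSlope d (t j)) → N ≤ n

/-- **piece 2 (depth confinement; = `rawConfinement` + `envelopeGap` + the Leibniz bookkeeping `det = Σ_τ rawCoef · X^{rawSlope}`).**
Every nonzero real root of a NONZERO pencil determinant of depth `≤ Δ` has `log₂|x|` within `m(log₂(mK)+1) + Δ` of a design breakpoint. [PROVED: `rootNearBreakpoint_proof`] -/
def RootNearBreakpoint : Prop :=
  ∀ (m K Δ : ℕ) (d : Fin K → ℕ) (S : Fin K → Matrix (Fin m) (Fin m) ℝ), DepthLE d S Δ →
    ∀ x : ℝ, x ≠ 0 → pencilDet d S ≠ 0 → (pencilDet d S).IsRoot x →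
      ∃ b ∈ designBreaks d S, |Real.logb 2 |x| - b| ≤ ((m * (Nat.log 2 (m * K) + 1) + Δ : ℕ) : ℝ)

/-- **piece 3 (unit-cell counting).**  Roots log-confined to `W`-neighbourhoods of a finite set `B` occupy at most `(2W+2)·#B` octaves. [PROVED: `cellCount_proof`] -/
def CellCount : Prop :=
  ∀ (p : Polynomial ℝ) (B : Finset ℝ) (W : ℕ), (∀ x : ℝ, x ≠ 0 → p ≠ 0 → p.IsRoot x → ∃ b ∈ B, |Real.logb 2 |x| - b| ≤ (W : ℝ)) →
    octaveCount p ≤ (2 * W + 2) * B.card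

/-- **the rung from its three pieces** (kernel-checked composition). [folklore] -/
theorem shallowOctaveLifting_of (h1 : DesignPiecesBound) (h2 : RootNearBreakpoint) (h3 : CellCount) : ShallowOctaveLifting := by
  intro m K n Δ hT d S hΔ
  have hB : (designBreaks d S).card ≤ n := h1 m K n hT d S
  have hW := h3 (pencilDet d S) (designBreaks d S) (m * (Nat.log 2 (m * K) + 1) + Δ)
    (fun x hx hp hr => h2 m K Δ d S hΔ x hx hp hr)
  calc octaveCount (pencilDet d S) ≤ (2 * (m * (Nat.log 2 (m * K) + 1) + Δ) + 2) * (designBreaks d S).card := hW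
    _ ≤ (2 * (m * (Nat.log 2 (m * K) + 1) + Δ) + 2) * n := Nat.mul_le_mul_left _ hB
    _ ≤ (2 * (m * (Nat.log 2 (m * K) + 1) + Δ) + 3) * (n + 1) := Nat.mul_le_mul (Nat.le_succ _) (Nat.le_succ _)

/-- **breakpoints ⇒ a real chain** (PROVED): the design breakpoints, sorted, are interleaved by `#breaks + 1` points; top terms there
have strictly increasing slope classes. -/
theorem designPiecesBound_of_realChainBound (h : RealChainBound) : DesignPiecesBound := by
  intro m K n hH d S
  classical
  set B := designBreaks d S with hB
  set N := B.card with hN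
  rcases Nat.eq_zero_or_pos N with h0 | hNpos
  · rw [h0]; exact Nat.zero_le _
  -- present terms exist
  set P := (univ : Finset (RawTerm m K)).filter (fun τ => rawCoef S τ ≠ 0) with hP
  have hPne : P.Nonempty := by
    obtain ⟨b, hb⟩ := Finset.card_pos.1 hNpos
    rw [hB, designBreaks, Finset.mem_image] at hb
    obtain ⟨kl, hkl, -⟩ := hb
    rw [Finset.mem_filter] at hkl
    exact ⟨kl.1, by rw [hP, Finset.mem_filter]; exact ⟨mem_univ _, hkl.2.1⟩⟩
  -- sorted breakpoints
  let b : Fin N → ℝ := fun i => B.orderEmbOfFin hN.symm i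
  have hbmono : StrictMono b := fun i j hij => (B.orderEmbOfFin hN.symm).strictMono hij
  have hbmem : ∀ i, b i ∈ B := fun i => Finset.orderEmbOfFin_mem B hN.symm i
  -- interleaving points
  let β : ℕ → ℝ := fun i => if h : i < N then b ⟨i, h⟩ else b ⟨N - 1, by omega⟩ + 1
  let βL : ℕ → ℝ := fun j => if j = 0 then b ⟨0, hNpos⟩ - 1 else β (j - 1)
  let θ : Fin (N + 1) → ℝ := fun j => (βL j + β j) / 2
  have hβ_eq : ∀ i : Fin N, β i = b i := fun i => by simp [β, i.2]
  have hβL_lt : ∀ i : Fin N, βL i < b i := by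
    intro i
    by_cases hi : (i : ℕ) = 0
    · have : i = ⟨0, hNpos⟩ := Fin.ext hi
      simp [βL, hi, this]
    · simp only [βL, hi, if_false]
      have hlt : (i : ℕ) - 1 < N := by omega
      simp only [β, hlt, dif_pos]
      exact hbmono (Fin.mk_lt_mk.2 (by omega) : (⟨(i : ℕ) - 1, hlt⟩ : Fin N) < ⟨i, i.2⟩)
  have hβ_gt : ∀ i : Fin N, b i < β ((i : ℕ) + 1) := by
    intro i
    by_cases hi : (i : ℕ) + 1 < N
    · simp only [β, hi, dif_pos]
      exact hbmono (Fin.mk_lt_mk.2 (by omega) : (⟨(i : ℕ), i.2⟩ : Fin N) < ⟨i + 1, hi⟩)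
    · simp only [β, hi, dif_neg, not_false_eq_true]
      have : i = ⟨N - 1, by omega⟩ := Fin.ext (by simp; omega)
      rw [← this]; linarith
  have hleft : ∀ i : Fin N, θ i.castSucc < b i := by
    intro i
    show (βL (i : ℕ) + β (i : ℕ)) / 2 < b i
    have := hβL_lt i; have := hβ_eq i; linarith
  have hright : ∀ i : Fin N, b i < θ i.succ := by
    intro i
    show b i < (βL ((i : ℕ) + 1) + β ((i : ℕ) + 1)) / 2
    have h1 : βL ((i : ℕ) + 1) = b i := by
      simp only [βL, Nat.add_one_ne_zero, if_false, Nat.add_sub_cancel]; exact hβ_eq i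
    have := hβ_gt i; linarith
  have hθmono : StrictMono θ := by
    refine Fin.strictMono_iff_lt_succ.2 fun i => ?_
    exact (hleft i).trans (hright i)
  -- top terms
  have htop : ∀ j : Fin (N + 1), ∃ t ∈ P, ∀ τ ∈ P, rawLine d S τ (θ j) ≤ rawLine d S t (θ j) :=
    fun j => Finset.exists_max_image P (fun τ => rawLine d S τ (θ j)) hPne
  choose t htP htmax using htop
  have hpres : ∀ j, rawCoef S (t j) ≠ 0 := fun j => by
    have := htP j; rw [hP, Finset.mem_filter] at this; exact this.2
  have hmax' : ∀ j τ, rawCoef S τ ≠ 0 → rawLine d S τ (θ j) ≤ rawLine d S (t j) (θ j) := fun j τ hτ =>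
    htmax j τ (by rw [hP, Finset.mem_filter]; exact ⟨mem_univ _, hτ⟩)
  -- slopes strictly increase across each breakpoint
  have hslope : StrictMono (fun j => rawSlope d (t j)) := by
    refine Fin.strictMono_iff_lt_succ.2 fun i => ?_
    have hb := hbmem i
    rw [hB, designBreaks, Finset.mem_image] at hb
    obtain ⟨kl, hkl, hc⟩ := hb
    rw [Finset.mem_filter] at hkl
    obtain ⟨-, hk, hl, hs, hall⟩ := hkl
    have hcross := rawLine_cross d S kl.1 kl.2 hs
    -- at c = b i : k on top (and l ties with k)
    have htopk : ∀ τ, rawCoef S τ ≠ 0 → rawLine d S τ (b i) ≤ rawLine d S kl.1 (b i) := fun τ hτ => by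
      have := hall τ hτ; rw [hc] at this; simpa [rawLine] using this
    have htopl : ∀ τ, rawCoef S τ ≠ 0 → rawLine d S τ (b i) ≤ rawLine d S kl.2 (b i) := fun τ hτ => by
      have h1 := htopk τ hτ
      have h2 : rawLine d S kl.1 (b i) = rawLine d S kl.2 (b i) := by rw [← hc]; exact hcross
      linarith
    have a1 : rawSlope d (t i.castSucc) ≤ rawSlope d kl.1 :=
      slope_le_of_top_left (hleft i) (hmax' _ kl.1 hk) (htopk _ (hpres _))
    have a2 : rawSlope d (t i.castSucc) ≤ rawSlope d kl.2 :=
      slope_le_of_top_left (hleft i) (hmax' _ kl.2 hl) (htopl _ (hpres _))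
    have a3 : rawSlope d kl.1 ≤ rawSlope d (t i.succ) :=
      le_slope_of_top_right (hright i) (hmax' _ kl.1 hk) (htopk _ (hpres _))
    have a4 : rawSlope d kl.2 ≤ rawSlope d (t i.succ) :=
      le_slope_of_top_right (hright i) (hmax' _ kl.2 hl) (htopl _ (hpres _))
    show rawSlope d (t i.castSucc) < rawSlope d (t i.succ)
    rcases lt_or_gt_of_ne hs with h | h <;> omega
  -- the sample points are not breakpoints, so ties there stay inside one slope class
  have HL : ∀ (j : Fin (N + 1)) (i : Fin N), (i : ℕ) < j → b i < θ j := by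
    intro j i hij
    refine (hright i).trans_le (hθmono.monotone ?_)
    exact Fin.le_iff_val_le_val.2 (by simp; omega)
  have HR : ∀ (j : Fin (N + 1)) (i : Fin N), (j : ℕ) ≤ i → θ j < b i := by
    intro j i hji
    refine lt_of_le_of_lt (hθmono.monotone ?_) (hleft i)
    exact Fin.le_iff_val_le_val.2 (by simp; omega)
  have hnot : ∀ j, θ j ∉ B := by
    intro j hj
    have hr : θ j ∈ Set.range (B.orderEmbOfFin hN.symm) := by rw [Finset.range_orderEmbOfFin]; exact hj
    obtain ⟨i, hi⟩ := hr
    change b i = θ j at hi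
    rcases lt_or_ge (i : ℕ) (j : ℕ) with hij | hji
    · exact absurd hi (HL j i hij).ne
    · exact absurd hi (HR j i hji).ne'
  have htie : ∀ j τ, rawCoef S τ ≠ 0 → rawLine d S τ (θ j) = rawLine d S (t j) (θ j) → rawSlope d τ = rawSlope d (t j) := by
    intro j τ hτ heq
    by_contra hs
    apply hnot j
    rw [hB, designBreaks, Finset.mem_image]
    refine ⟨(t j, τ), ?_, rawCross_eq_of_tie d S (t j) τ (Ne.symm hs) heq.symm⟩
    rw [Finset.mem_filter]
    refine ⟨mem_univ _, hpres j, hτ, Ne.symm hs, fun t' ht' => ?_⟩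
    rw [rawCross_eq_of_tie d S (t j) τ (Ne.symm hs) heq.symm]
    have := hmax' j t' ht'
    simpa [rawLine] using this
  exact h m K n hH d S N θ t hθmono hpres hmax' htie hslope

/-! ### Integerisation: real chains obey the integer tropical row (`RealChainBound`, PROVED) -/

section Integerisation

open Summit.ValiantsHypothesis.ValiantsHypothesis.Theorems.MatrixDescartes.Negative (termSign IsDominant tropWeight)
open Summit.ValiantsHypothesis.ValiantsHypothesis.Theorems.KPlusLogSqLaw (TropRowD DesignRowD)

/-- entries `(row, column, letter)` used by a raw term. -/
def ent (τ : RawTerm m K) (i : Fin m) : Fin m × Fin m × Fin K := (τ.1 i, i, τ.2 i)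

theorem ent_injective (τ : RawTerm m K) : Function.Injective (ent τ) := fun i j h => by
  have := congrArg (fun e => e.2.1) h
  simpa [ent] using this

theorem eq_of_image_ent_eq {τ τ' : RawTerm m K} (h : univ.image (ent τ) = univ.image (ent τ')) : τ = τ' := by
  classical
  have key : ∀ i, τ.1 i = τ'.1 i ∧ τ.2 i = τ'.2 i := by
    intro i
    have hi : ent τ i ∈ univ.image (ent τ') := by rw [← h]; exact mem_image_of_mem _ (mem_univ i)
    obtain ⟨i', -, hi'⟩ := mem_image.1 hi
    simp only [ent, Prod.mk.injEq] at hi'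
    obtain ⟨h1, h2, h3⟩ := hi'
    subst h2
    exact ⟨h1.symm, h3.symm⟩
  refine Prod.ext (Equiv.ext fun i => (key i).1) (funext fun i => (key i).2)

/-- binary (lexicographic) tie-breaker of a raw term w.r.t. an indexing of the entries. -/
def tieBreak (idx : Fin m × Fin m × Fin K → ℕ) (τ : RawTerm m K) : ℕ := ∑ i, 2 ^ idx (ent τ i)

theorem tieBreak_eq_sum_image (idx : Fin m × Fin m × Fin K → ℕ) (hidx : Function.Injective idx) (τ : RawTerm m K) :
    tieBreak idx τ = ∑ k ∈ (univ.image (ent τ)).image idx, 2 ^ k := by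
  classical
  rw [tieBreak, Finset.sum_image (fun a _ b _ h => hidx h), Finset.sum_image (fun a _ b _ h => ent_injective τ h)]

/-- distinct raw terms have distinct tie-breakers (binary expansions are unique: `Finset.equivBitIndices`). -/
theorem tieBreak_injective (idx : Fin m × Fin m × Fin K → ℕ) (hidx : Function.Injective idx) :
    Function.Injective (tieBreak (m := m) (K := K) idx) := by
  classical
  intro τ τ' h
  rw [tieBreak_eq_sum_image idx hidx, tieBreak_eq_sum_image idx hidx] at h
  have key : ∀ s : Finset ℕ, Finset.equivBitIndices.symm s = ∑ i ∈ s, 2 ^ i := fun s => rfl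
  rw [← key, ← key] at h
  have h2 := Finset.equivBitIndices.symm.injective h
  exact eq_of_image_ent_eq (Finset.image_injective hidx h2)

theorem sum_range_two_pow_lt (W : ℕ) : ∑ k ∈ range W, 2 ^ k < 2 ^ W := by
  induction W with
  | zero => simp
  | succ n ih => rw [Finset.sum_range_succ, pow_succ]; omega

theorem tieBreak_lt (idx : Fin m × Fin m × Fin K → ℕ) (hidx : Function.Injective idx) (W : ℕ) (hW : ∀ e, idx e < W)
    (τ : RawTerm m K) : tieBreak idx τ < 2 ^ W := by
  classical
  rw [tieBreak_eq_sum_image idx hidx]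
  refine lt_of_le_of_lt (Finset.sum_le_sum_of_subset fun k hk => ?_) (sum_range_two_pow_lt W)
  obtain ⟨e, -, rfl⟩ := mem_image.1 hk
  exact mem_range.2 (hW e)

/-- presence: the 0/1 pattern of `S` marks exactly the raw terms with nonzero value. -/
theorem termSign_pattern_ne_zero_iff (S : Fin K → Matrix (Fin m) (Fin m) ℝ) (τ : RawTerm m K) :
    termSign (fun a b l => if S l a b = 0 then (0 : ℤ) else 1) τ ≠ 0 ↔ rawCoef S τ ≠ 0 := by
  rw [termSign, rawCoef, mul_ne_zero_iff, mul_ne_zero_iff, Finset.prod_ne_zero_iff, Finset.prod_ne_zero_iff]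
  have h1 : ((Equiv.Perm.sign τ.1 : ℤ)) ≠ 0 := Units.ne_zero _
  have h2 : (((Equiv.Perm.sign τ.1 : ℤ)) : ℝ) ≠ 0 := by exact_mod_cast h1
  simp only [h1, h2, true_and, ne_eq, mem_univ, true_implies, ite_eq_left_iff, one_ne_zero, imp_false, not_not]

/-- slope classes are bounded by `m · Σ_l d_l`. -/
theorem rawSlope_le (d : Fin K → ℕ) (τ : RawTerm m K) : rawSlope d τ ≤ m * ∑ l, d l := by
  rw [rawSlope]
  calc ∑ i, d (τ.2 i) ≤ ∑ _i : Fin m, ∑ l, d l :=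
        Finset.sum_le_sum fun i _ => Finset.single_le_sum (f := d) (fun l _ => Nat.zero_le _) (mem_univ (τ.2 i))
    _ = m * ∑ l, d l := by rw [Finset.sum_const, card_univ, Fintype.card_fin, smul_eq_mul]

/-- log of a present raw term = sum of the entry logs. -/
theorem rawLog_eq_sum (S : Fin K → Matrix (Fin m) (Fin m) ℝ) (τ : RawTerm m K) (hτ : rawCoef S τ ≠ 0) :
    rawLog S τ = ∑ i, Real.logb 2 |S (τ.2 i) (τ.1 i) i| := by
  have habs : |rawCoef S τ| = ∏ i, |S (τ.2 i) (τ.1 i) i| := by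
    rw [rawCoef, abs_mul, ← Finset.abs_prod]
    have : |((Equiv.Perm.sign τ.1 : ℤ) : ℝ)| = 1 := by
      rcases Int.units_eq_one_or (Equiv.Perm.sign τ.1) with h | h <;> simp [h]
    rw [this, one_mul]
  have hne : ∀ i, S (τ.2 i) (τ.1 i) i ≠ 0 := by
    have := hτ; rw [rawCoef, mul_ne_zero_iff, Finset.prod_ne_zero_iff] at this
    exact fun i => this.2 i (mem_univ i)
  rw [rawLog, habs, Real.logb_prod]
  exact fun i _ => abs_ne_zero.2 (hne i)

/-- **INTEGERISATION** (PROVED): real chains obey the integer tropical row. -/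
theorem realChainBound_proof : RealChainBound := by
  intro m K n hT d S N θ t hθ hpres hmax htie hslope
  classical
  rcases Nat.eq_zero_or_pos N with h0 | hNpos
  · omega
  -- indexing of the entries
  let idx : Fin m × Fin m × Fin K → ℕ := fun e => (Fintype.equivFin (Fin m × Fin m × Fin K) e : ℕ)
  have hidx : Function.Injective idx := fun a b h => (Fintype.equivFin _).injective (Fin.ext h)
  set W : ℕ := Fintype.card (Fin m × Fin m × Fin K) with hW
  have hidxW : ∀ e, idx e < W := fun e => (Fintype.equivFin _ e).2
  -- margin μ: competitors of another slope class are strictly below the top, uniformly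
  have hstrict : ∀ j τ, rawCoef S τ ≠ 0 → rawSlope d τ ≠ rawSlope d (t j) →
      0 < rawLine d S (t j) (θ j) - rawLine d S τ (θ j) := by
    intro j τ hτ hs
    have h1 := hmax j τ hτ
    rcases h1.lt_or_eq with hlt | heq
    · linarith
    · exact absurd (htie j τ hτ heq) hs
  obtain ⟨μ, hμ, hμle⟩ : ∃ μ : ℝ, 0 < μ ∧ ∀ j τ, rawCoef S τ ≠ 0 → rawSlope d τ ≠ rawSlope d (t j) →
      μ ≤ rawLine d S (t j) (θ j) - rawLine d S τ (θ j) := by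
    let G : Finset ℝ := ((univ : Finset (Fin (N + 1) × RawTerm m K)).filter
        (fun jτ => rawCoef S jτ.2 ≠ 0 ∧ rawSlope d jτ.2 ≠ rawSlope d (t jτ.1))).image
        (fun jτ => rawLine d S (t jτ.1) (θ jτ.1) - rawLine d S jτ.2 (θ jτ.1))
    have hmemG : ∀ j τ, rawCoef S τ ≠ 0 → rawSlope d τ ≠ rawSlope d (t j) →
        rawLine d S (t j) (θ j) - rawLine d S τ (θ j) ∈ G := fun j τ hτ hs =>
      mem_image.2 ⟨(j, τ), mem_filter.2 ⟨mem_univ _, hτ, hs⟩, rfl⟩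
    by_cases hG : G.Nonempty
    · refine ⟨G.min' hG, ?_, fun j τ hτ hs => G.min'_le _ (hmemG j τ hτ hs)⟩
      have hmin := G.min'_mem hG
      obtain ⟨jτ, hjτ, hval⟩ := mem_image.1 hmin
      rw [mem_filter] at hjτ
      rw [← hval]
      exact hstrict jτ.1 jτ.2 hjτ.2.1 hjτ.2.2
    · refine ⟨1, one_pos, fun j τ hτ hs => absurd ⟨_, hmemG j τ hτ hs⟩ hG⟩
  -- gap g of the sample points
  obtain ⟨g, hg, hgle⟩ : ∃ g : ℝ, 0 < g ∧ ∀ i : Fin N, g ≤ θ i.succ - θ i.castSucc := by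
    let G2 : Finset ℝ := (univ : Finset (Fin N)).image (fun i => θ i.succ - θ i.castSucc)
    have hG2 : G2.Nonempty := ⟨_, mem_image_of_mem _ (mem_univ (⟨0, hNpos⟩ : Fin N))⟩
    refine ⟨G2.min' hG2, ?_, fun i => G2.min'_le _ (mem_image_of_mem _ (mem_univ i))⟩
    obtain ⟨i, -, hi⟩ := mem_image.1 (G2.min'_mem hG2)
    rw [← hi]
    exact sub_pos.2 (hθ (show Fin.castSucc i < i.succ from Fin.castSucc_lt_succ))
  -- the scale Q
  set sB : ℕ := m * ∑ l, d l with hsB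
  obtain ⟨Q, hQ⟩ := exists_nat_gt (max (1 / g) (((sB : ℝ) + m + 1) / μ))
  have hQg : 1 < (Q : ℝ) * g := by
    have := (le_max_left _ _).trans_lt hQ
    rw [div_lt_iff₀ hg] at this; linarith
  have hQμ : (sB : ℝ) + m + 1 < Q * μ := by
    have := (le_max_right _ _).trans_lt hQ
    rw [div_lt_iff₀ hμ] at this; linarith
  have hQpos : (0 : ℝ) < Q := by
    have : (0:ℝ) < 1 / g := by positivity
    exact this.trans ((le_max_left _ _).trans_lt hQ)
  -- the integer design and slopes
  let v' : Fin m → Fin m → Fin K → ℤ := fun a b l =>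
    -((2 : ℤ) ^ W * ⌊(Q : ℝ) * Real.logb 2 |S l a b|⌋ + (2 : ℤ) ^ idx (a, b, l))
  let ε' : Fin m → Fin m → Fin K → ℤ := fun a b l => if S l a b = 0 then 0 else 1
  let θ' : Fin (N + 1) → ℤ := fun j => (2 : ℤ) ^ W * ⌊(Q : ℝ) * θ j⌋
  let A : Fin (N + 1) → RawTerm m K → ℤ := fun j τ =>
    ⌊(Q : ℝ) * θ j⌋ * (rawSlope d τ : ℤ) + ∑ i, ⌊(Q : ℝ) * Real.logb 2 |S (τ.2 i) (τ.1 i) i|⌋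
  have hdecomp : ∀ j τ, tropWeight d v' (θ' j) τ = 2 ^ W * A j τ + (tieBreak idx τ : ℤ) := by
    intro j τ
    simp only [tropWeight, v', θ', A, tieBreak, ent, rawSlope, Finset.sum_neg_distrib, sub_neg_eq_add,
      Finset.sum_add_distrib, Nat.cast_sum, Nat.cast_pow, Nat.cast_ofNat, Finset.mul_sum, Finset.sum_mul]
    ring_nf
    simp only [Finset.sum_mul, Finset.mul_sum]
    ring
  have hpresent : ∀ τ, termSign ε' τ ≠ 0 ↔ rawCoef S τ ≠ 0 := fun τ => termSign_pattern_ne_zero_iff S τ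
  -- comparison of weights ⇒ comparison of the integer parts
  have hAle : ∀ j τ τ', tropWeight d v' (θ' j) τ ≤ tropWeight d v' (θ' j) τ' → A j τ ≤ A j τ' := by
    intro j τ τ' hle
    rw [hdecomp, hdecomp] at hle
    have b1 : (tieBreak idx τ' : ℤ) < 2 ^ W := by exact_mod_cast tieBreak_lt idx hidx W hidxW τ'
    have b2 : (0 : ℤ) ≤ tieBreak idx τ := by positivity
    by_contra hlt
    push_neg at hlt
    have h1 : 1 ≤ A j τ - A j τ' := by omega
    have h2 : (2 : ℤ) ^ W * 1 ≤ 2 ^ W * (A j τ - A j τ') := mul_le_mul_of_nonneg_left h1 (by positivity)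
    nlinarith
  have hdistinct : ∀ j τ τ', τ ≠ τ' → tropWeight d v' (θ' j) τ ≠ tropWeight d v' (θ' j) τ' := by
    intro j τ τ' hne heq
    have hA : A j τ = A j τ' := le_antisymm (hAle j τ τ' heq.le) (hAle j τ' τ heq.ge)
    rw [hdecomp, hdecomp, hA] at heq
    have : tieBreak idx τ = tieBreak idx τ' := by exact_mod_cast (add_left_cancel heq)
    exact hne (tieBreak_injective idx hidx this)
  -- dominant terms of the integer design at the integer slopes
  set P' := (univ : Finset (RawTerm m K)).filter (fun τ => termSign ε' τ ≠ 0) with hP'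
  have hP'ne : P'.Nonempty :=
    ⟨t 0, by rw [hP', mem_filter]; exact ⟨mem_univ _, (hpresent _).2 (hpres _)⟩⟩
  have hdomEx : ∀ j, ∃ p ∈ P', ∀ τ ∈ P', tropWeight d v' (θ' j) τ ≤ tropWeight d v' (θ' j) p :=
    fun j => exists_max_image P' _ hP'ne
  choose p hpP' hpmax using hdomEx
  have hp_pres : ∀ j, rawCoef S (p j) ≠ 0 := fun j => by
    have := hpP' j; rw [hP', mem_filter] at this; exact (hpresent _).1 this.2
  have hdom : ∀ j, IsDominant d v' ε' (θ' j) (p j) := by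
    intro j
    refine ⟨(hpresent _).2 (hp_pres j), fun q hq hqs => ?_⟩
    have hle := hpmax j q (by rw [hP', mem_filter]; exact ⟨mem_univ _, hqs⟩)
    exact lt_of_le_of_ne hle (hdistinct j q (p j) hq)
  -- the integer part sandwiches Q · (real line)
  have hAlow : ∀ j τ, rawCoef S τ ≠ 0 → (Q : ℝ) * rawLine d S τ (θ j) - (rawSlope d τ + m) ≤ A j τ := by
    intro j τ hτ
    have hfl1 : (Q : ℝ) * θ j - 1 < ⌊(Q : ℝ) * θ j⌋ := by
      have := Int.lt_floor_add_one ((Q : ℝ) * θ j); linarith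
    have hs0 : (0 : ℝ) ≤ rawSlope d τ := Nat.cast_nonneg _
    have h1 : ((Q : ℝ) * θ j - 1) * rawSlope d τ ≤ (⌊(Q : ℝ) * θ j⌋ : ℝ) * rawSlope d τ :=
      mul_le_mul_of_nonneg_right hfl1.le hs0
    have h2 : ∀ i, (Q : ℝ) * Real.logb 2 |S (τ.2 i) (τ.1 i) i| - 1 < ⌊(Q : ℝ) * Real.logb 2 |S (τ.2 i) (τ.1 i) i|⌋ :=
      fun i => by have := Int.lt_floor_add_one ((Q : ℝ) * Real.logb 2 |S (τ.2 i) (τ.1 i) i|); linarith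
    have h3 : ∑ i, ((Q : ℝ) * Real.logb 2 |S (τ.2 i) (τ.1 i) i| - 1) ≤
        ∑ i, (⌊(Q : ℝ) * Real.logb 2 |S (τ.2 i) (τ.1 i) i|⌋ : ℝ) := Finset.sum_le_sum fun i _ => (h2 i).le
    have h3' : ∑ i : Fin m, ((Q : ℝ) * Real.logb 2 |S (τ.2 i) (τ.1 i) i| - 1) =
        Q * ∑ i, Real.logb 2 |S (τ.2 i) (τ.1 i) i| - m := by
      rw [Finset.sum_sub_distrib, Finset.mul_sum]; simp
    rw [rawLine, rawLog_eq_sum S τ hτ]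
    have hA : (A j τ : ℝ) = (⌊(Q : ℝ) * θ j⌋ : ℝ) * rawSlope d τ + ∑ i, (⌊(Q : ℝ) * Real.logb 2 |S (τ.2 i) (τ.1 i) i|⌋ : ℝ) := by
      simp [A]
    rw [hA]
    linarith [h1, h3, h3']
  have hAup : ∀ j τ, rawCoef S τ ≠ 0 → (A j τ : ℝ) ≤ (Q : ℝ) * rawLine d S τ (θ j) := by
    intro j τ hτ
    have hs0 : (0 : ℝ) ≤ rawSlope d τ := Nat.cast_nonneg _
    have h1 : (⌊(Q : ℝ) * θ j⌋ : ℝ) * rawSlope d τ ≤ ((Q : ℝ) * θ j) * rawSlope d τ :=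
      mul_le_mul_of_nonneg_right (Int.floor_le _) hs0
    have h3 : ∑ i, (⌊(Q : ℝ) * Real.logb 2 |S (τ.2 i) (τ.1 i) i|⌋ : ℝ) ≤ (Q : ℝ) * ∑ i, Real.logb 2 |S (τ.2 i) (τ.1 i) i| := by
      rw [Finset.mul_sum]; exact Finset.sum_le_sum fun i _ => Int.floor_le _
    rw [rawLine, rawLog_eq_sum S τ hτ]
    have hA : (A j τ : ℝ) = (⌊(Q : ℝ) * θ j⌋ : ℝ) * rawSlope d τ + ∑ i, (⌊(Q : ℝ) * Real.logb 2 |S (τ.2 i) (τ.1 i) i|⌋ : ℝ) := by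
      simp [A]
    rw [hA]
    linarith [h1, h3]
  -- near-topness of p j against t j, hence same slope class
  have hsp : ∀ j, rawSlope d (p j) = rawSlope d (t j) := by
    intro j
    by_contra hs
    have hμ1 := hμle j (p j) (hp_pres j) hs
    have hw : tropWeight d v' (θ' j) (t j) ≤ tropWeight d v' (θ' j) (p j) :=
      hpmax j (t j) (by rw [hP', mem_filter]; exact ⟨mem_univ _, (hpresent _).2 (hpres _)⟩)
    have hA1 : (A j (t j) : ℝ) ≤ A j (p j) := by exact_mod_cast hAle j _ _ hw
    have hlo := hAlow j (t j) (hpres j)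
    have hup := hAup j (p j) (hp_pres j)
    have hsl : (rawSlope d (t j) : ℝ) ≤ sB := by exact_mod_cast rawSlope_le d (t j)
    -- Q · gap < sB + m + 1 < Q μ ≤ Q · gap : contradiction
    have hgap : (Q : ℝ) * (rawLine d S (t j) (θ j) - rawLine d S (p j) (θ j)) < sB + m + 1 := by linarith
    have : (Q : ℝ) * μ ≤ Q * (rawLine d S (t j) (θ j) - rawLine d S (p j) (θ j)) :=
      mul_le_mul_of_nonneg_left hμ1 hQpos.le
    linarith
  -- the integer chain is admissible
  have hθ' : StrictMono θ' := by
    refine Fin.strictMono_iff_lt_succ.2 fun i => ?_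
    have hgi := hgle i
    have h1 : (Q : ℝ) * θ i.castSucc + 1 ≤ (Q : ℝ) * θ i.succ := by nlinarith
    have h2 : ⌊(Q : ℝ) * θ i.castSucc⌋ + 1 ≤ ⌊(Q : ℝ) * θ i.succ⌋ := by
      rw [← Int.floor_add_one]; exact Int.floor_le_floor h1
    show (2 : ℤ) ^ W * ⌊(Q : ℝ) * θ i.castSucc⌋ < 2 ^ W * ⌊(Q : ℝ) * θ i.succ⌋
    exact mul_lt_mul_of_pos_left (by omega) (by positivity)
  have hne : ∀ i : Fin N, p i.castSucc ≠ p i.succ := by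
    intro i heq
    have h1 := hslope (show Fin.castSucc i < i.succ from Fin.castSucc_lt_succ)
    simp only at h1
    rw [← hsp, ← hsp, heq] at h1
    exact lt_irrefl _ h1
  exact hT d v' ε' N θ' p hθ' hdom hne

end Integerisation

/-- piece 1, PROVED: `TropRowD m K n ⇒ #designBreaks ≤ n` for every real pencil design. -/
theorem designPiecesBound_proof : DesignPiecesBound :=
  designPiecesBound_of_realChainBound realChainBound_proof

/-- Leibniz bookkeeping: the pencil determinant is the sum of its raw terms. -/
theorem pencilDet_eq_sum (d : Fin K → ℕ) (S : Fin K → Matrix (Fin m) (Fin m) ℝ) :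
    pencilDet d S = ∑ τ : RawTerm m K, Polynomial.C (rawCoef S τ) * Polynomial.X ^ (rawSlope d τ) := by
  classical
  unfold pencilDet
  rw [Matrix.det_apply', Fintype.sum_prod_type]
  refine Finset.sum_congr rfl fun σ _ => ?_
  have hentry : ∀ i, (∑ l, ((Polynomial.X : Polynomial ℝ) ^ d l) • (S l).map Polynomial.C) (σ i) i
      = ∑ l, Polynomial.X ^ d l * Polynomial.C (S l (σ i) i) := by
    intro i
    simp [Matrix.sum_apply, Matrix.smul_apply, Matrix.map_apply, smul_eq_mul]
  rw [Finset.prod_congr rfl fun i _ => hentry i, Finset.prod_univ_sum, Finset.mul_sum]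
  simp only [Fintype.piFinset_univ]
  refine Finset.sum_congr rfl fun lam _ => ?_
  rw [Finset.prod_mul_distrib, Finset.prod_pow_eq_pow_sum, rawCoef, rawSlope, map_mul, map_intCast, map_prod]
  ring

/-- Evaluation of the pencil determinant as the sum of its raw Leibniz terms. [folklore] -/
theorem eval_pencilDet_eq_sum (d : Fin K → ℕ) (S : Fin K → Matrix (Fin m) (Fin m) ℝ) (x : ℝ) :
    (pencilDet d S).eval x = ∑ τ : RawTerm m K, rawCoef S τ * x ^ (rawSlope d τ) := by
  rw [pencilDet_eq_sum, Polynomial.eval_finset_sum]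
  simp [Polynomial.eval_mul, Polynomial.eval_pow, Polynomial.eval_C, Polynomial.eval_X]

/-- A coefficient of the pencil determinant is the signed sum of the raw terms of its slope class. [folklore] -/
theorem coeff_pencilDet_eq_sum (d : Fin K → ℕ) (S : Fin K → Matrix (Fin m) (Fin m) ℝ) (e : ℕ) :
    (pencilDet d S).coeff e = ∑ τ ∈ univ.filter (fun τ : RawTerm m K => rawSlope d τ = e), rawCoef S τ := by
  classical
  rw [pencilDet_eq_sum, Polynomial.finset_sum_coeff, Finset.sum_filter]
  refine Finset.sum_congr rfl fun τ _ => ?_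
  rw [Polynomial.coeff_C_mul_X_pow]
  by_cases h : rawSlope d τ = e
  · simp [h]
  · simp [h, Ne.symm h]


/-- Absolute value of a raw term = product of the absolute entries. [folklore] -/
theorem abs_rawCoef (S : Fin K → Matrix (Fin m) (Fin m) ℝ) (τ : RawTerm m K) : |rawCoef S τ| = ∏ i, |S (τ.2 i) (τ.1 i) i| := by
  rw [rawCoef, abs_mul, ← Finset.abs_prod]
  have : |((Equiv.Perm.sign τ.1 : ℤ) : ℝ)| = 1 := by
    rcases Int.units_eq_one_or (Equiv.Perm.sign τ.1) with h | h <;> simp [h]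
  rw [this, one_mul]

/-- There are at most `2^{m(⌊log₂(mK)⌋+1)}` raw Leibniz terms (`m!·K^m ≤ (mK)^m`). [folklore] -/
theorem card_rawTerm_le (m K : ℕ) : Fintype.card (RawTerm m K) ≤ 2 ^ (m * (Nat.log 2 (m * K) + 1)) := by
  classical
  have h1 : Fintype.card (Equiv.Perm (Fin m)) ≤ Fintype.card (Fin m → Fin m) :=
    Fintype.card_le_of_injective (fun σ : Equiv.Perm (Fin m) => (σ : Fin m → Fin m)) (fun a b h => Equiv.ext (congrFun h))
  rw [Fintype.card_prod]
  calc Fintype.card (Equiv.Perm (Fin m)) * Fintype.card (Fin m → Fin K)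
      ≤ Fintype.card (Fin m → Fin m) * Fintype.card (Fin m → Fin K) := Nat.mul_le_mul_right _ h1
    _ = (m * K) ^ m := by simp [Fintype.card_fun, mul_pow]
    _ ≤ (2 ^ (Nat.log 2 (m * K) + 1)) ^ m := Nat.pow_le_pow_left (Nat.lt_pow_succ_log_self (by norm_num) _).le _
    _ = 2 ^ (m * (Nat.log 2 (m * K) + 1)) := by rw [← pow_mul, mul_comm]

/-- `r/|r| = ±1` for `r ≠ 0`. [folklore] -/
theorem sign_div_abs (r : ℝ) (hr : r ≠ 0) : r / |r| = 1 ∨ r / |r| = -1 := by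
  rcases lt_or_gt_of_ne hr with h | h
  · right; rw [abs_of_neg h, div_neg, div_self hr]
  · left; rw [abs_of_pos h, div_self hr]

/-- **piece 2, PROVED** (depth confinement). [folklore] -/
theorem rootNearBreakpoint_proof : RootNearBreakpoint := by
  intro m K Δ d S hΔ x hx0 hf0 hroot
  classical
  set y := |x| with hy_def
  have hy : 0 < y := abs_pos.2 hx0
  have hyne : y ≠ 0 := hy.ne'
  set u := x / |x| with hu_def
  have hu : u = 1 ∨ u = -1 := sign_div_abs x hx0
  have huy : u * y = x := by rw [hu_def, hy_def]; exact div_mul_cancel₀ x (abs_ne_zero.2 hx0)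
  have hupow : ∀ n : ℕ, u ^ n = 1 ∨ u ^ n = -1 := fun n => by
    rcases hu with h | h
    · left; simp [h]
    · rw [h]; exact neg_one_pow_eq_or ℝ n
  -- the data for `rawConfinement` over ALL raw terms
  let a : RawTerm m K → ℝ := fun τ => |rawCoef S τ|
  let sg : RawTerm m K → ℝ := fun τ => if rawCoef S τ = 0 then 1 else rawCoef S τ / |rawCoef S τ| * u ^ rawSlope d τ
  have ha : ∀ τ, 0 ≤ a τ := fun τ => abs_nonneg _
  have hsg : ∀ τ, sg τ = 1 ∨ sg τ = -1 := fun τ => by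
    by_cases h : rawCoef S τ = 0
    · left; simp [sg, h]
    · simp only [sg, if_neg h]
      rcases sign_div_abs _ h with h1 | h1 <;> rcases hupow (rawSlope d τ) with h2 | h2 <;> simp [h1, h2]
  have hF1 : ∀ τ, sg τ * a τ = rawCoef S τ * u ^ rawSlope d τ := fun τ => by
    by_cases h : rawCoef S τ = 0
    · simp [sg, a, h]
    · simp only [sg, a, if_neg h]
      field_simp
  have hF2 : ∀ τ, sg τ * a τ * y ^ rawSlope d τ = rawCoef S τ * x ^ rawSlope d τ := fun τ => by
    rw [hF1, mul_assoc, ← mul_pow, huy]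
  -- root equation
  have hroot' : ∑ τ, sg τ * a τ * y ^ (rawSlope d τ) = 0 := by
    simp_rw [hF2]; rw [← eval_pencilDet_eq_sum]; exact hroot
  -- depth hypothesis in raw currency
  have hdepth' : ∀ e : ℕ, (∑ τ ∈ univ.filter (fun τ => rawSlope d τ = e), a τ) ≤
      (2 : ℝ) ^ Δ * |∑ τ ∈ univ.filter (fun τ => rawSlope d τ = e), sg τ * a τ| := by
    intro e
    have hL : (∑ τ ∈ univ.filter (fun τ => rawSlope d τ = e), a τ) =
        ∑ σ : Equiv.Perm (Fin m), ∑ lam : Fin m → Fin K, (if (∑ i, d (lam i)) = e then ∏ i, |S (lam i) (σ i) i| else 0) := by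
      rw [Finset.sum_filter, Fintype.sum_prod_type]
      refine Finset.sum_congr rfl fun σ _ => Finset.sum_congr rfl fun lam _ => ?_
      simp only [a, rawSlope, abs_rawCoef]
    have hR : (∑ τ ∈ univ.filter (fun τ => rawSlope d τ = e), sg τ * a τ) = u ^ e * (pencilDet d S).coeff e := by
      rw [coeff_pencilDet_eq_sum, Finset.mul_sum]
      refine Finset.sum_congr rfl fun τ hτ => ?_
      rw [hF1, (Finset.mem_filter.1 hτ).2, mul_comm]
    rw [hL, hR, abs_mul]
    have : |u ^ e| = 1 := by rcases hupow e with h | h <;> simp [h]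
    rw [this, one_mul]
    exact hΔ e
  -- a present term exists, pick the top raw term τ₀
  obtain ⟨e₀, he₀⟩ : ∃ e, (pencilDet d S).coeff e ≠ 0 := by
    by_contra hall; push_neg at hall
    exact hf0 (Polynomial.ext fun e => by simpa using hall e)
  obtain ⟨τp, -, hτp⟩ : ∃ τ ∈ univ.filter (fun τ : RawTerm m K => rawSlope d τ = e₀), rawCoef S τ ≠ 0 := by
    rw [coeff_pencilDet_eq_sum] at he₀
    exact Finset.exists_ne_zero_of_sum_ne_zero he₀
  obtain ⟨τ₀, -, hmax⟩ := Finset.exists_max_image (univ : Finset (RawTerm m K)) (fun τ => a τ * y ^ rawSlope d τ) ⟨τp, mem_univ _⟩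
  have hpos_p : 0 < a τp * y ^ rawSlope d τp := mul_pos (abs_pos.2 hτp) (pow_pos hy _)
  have hpos₀ : 0 < a τ₀ * y ^ rawSlope d τ₀ := hpos_p.trans_le (hmax τp (mem_univ _))
  have ha₀ : 0 < a τ₀ := by
    by_contra h; push_neg at h
    have : a τ₀ * y ^ rawSlope d τ₀ ≤ 0 := mul_nonpos_of_nonpos_of_nonneg h (pow_pos hy _).le
    linarith
  obtain ⟨τ₁, hs₁, hconf⟩ := rawConfinement (rawSlope d) a ha sg hsg Δ hdepth' y hy hroot' τ₀ ha₀
  set N := Fintype.card (RawTerm m K) with hN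
  have hNpos : 0 < (N : ℝ) := by
    have : 0 < N := Fintype.card_pos_iff.2 ⟨τ₀⟩
    exact_mod_cast this
  have ha₁ : 0 < a τ₁ := by
    by_contra h; push_neg at h
    have h0 : a τ₁ = 0 := le_antisymm h (ha τ₁)
    rw [h0, zero_mul, mul_zero] at hconf
    linarith
  -- pass to logs over PRESENT terms
  let ι := {τ : RawTerm m K // rawCoef S τ ≠ 0}
  have hτ₀p : rawCoef S τ₀ ≠ 0 := abs_pos.1 ha₀
  have hτ₁p : rawCoef S τ₁ ≠ 0 := abs_pos.1 ha₁
  set θ := Real.logb 2 y with hθ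
  have hlog_line : ∀ τ : RawTerm m K, rawCoef S τ ≠ 0 →
      Real.logb 2 (a τ * y ^ rawSlope d τ) = rawLog S τ + (rawSlope d τ : ℤ) * θ := by
    intro τ hτ
    rw [Real.logb_mul (abs_pos.2 hτ).ne' (pow_ne_zero _ hyne), Real.logb_pow, rawLog]
    push_cast; ring
  have htop : ∀ k : ι, rawLog S k.1 + (rawSlope d k.1 : ℤ) * θ ≤ rawLog S τ₀ + (rawSlope d τ₀ : ℤ) * θ := by
    intro k
    rw [← hlog_line k.1 k.2, ← hlog_line τ₀ hτ₀p]
    exact Real.logb_le_logb_of_le (by norm_num) (mul_pos (abs_pos.2 k.2) (pow_pos hy _)) (hmax k.1 (mem_univ _))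
  have hnear : rawLog S τ₀ + (rawSlope d τ₀ : ℤ) * θ ≤ rawLog S τ₁ + (rawSlope d τ₁ : ℤ) * θ + (Real.logb 2 N + Δ) := by
    rw [← hlog_line τ₀ hτ₀p, ← hlog_line τ₁ hτ₁p]
    have h1 := Real.logb_le_logb_of_le (b := 2) (by norm_num) hpos₀ hconf
    have h2 : Real.logb 2 (N * (2 : ℝ) ^ Δ * (a τ₁ * y ^ rawSlope d τ₁)) =
        Real.logb 2 N + Δ + Real.logb 2 (a τ₁ * y ^ rawSlope d τ₁) := by
      rw [Real.logb_mul (by positivity) (mul_pos ha₁ (pow_pos hy _)).ne', Real.logb_mul hNpos.ne' (by positivity),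
        Real.logb_pow, Real.logb_self_eq_one (by norm_num)]
      ring
    linarith
  have hs₁' : ((rawSlope d τ₀ : ℕ) : ℤ) ≠ ((rawSlope d τ₁ : ℕ) : ℤ) := by exact_mod_cast (Ne.symm hs₁)
  obtain ⟨b, hb, k, l, hkl, htie, hall⟩ := envelopeGap (ι := ι) (fun t => (rawSlope d t.1 : ℤ)) (fun t => rawLog S t.1)
    (Real.logb 2 N + Δ) θ ⟨τ₀, hτ₀p⟩ ⟨τ₁, hτ₁p⟩ hs₁' htop hnear
  -- identify b as the design breakpoint of (k, l)
  have hkl' : (rawSlope d k.1 : ℝ) ≠ rawSlope d l.1 := by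
    intro h; apply hkl; exact_mod_cast (show rawSlope d k.1 = rawSlope d l.1 by exact_mod_cast h)
  have hbcross : rawCross d S (k.1, l.1) = b := by
    rw [rawCross]
    have htie' : rawLog S k.1 + (rawSlope d k.1 : ℝ) * b = rawLog S l.1 + (rawSlope d l.1 : ℝ) * b := by
      simpa [Int.cast_natCast] using htie
    rw [div_eq_iff (sub_ne_zero.2 (Ne.symm hkl'))]
    linarith
  refine ⟨b, ?_, ?_⟩
  · rw [designBreaks, Finset.mem_image]
    refine ⟨(k.1, l.1), ?_, hbcross⟩
    rw [Finset.mem_filter]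
    refine ⟨mem_univ _, k.2, l.2, fun h => hkl (by exact_mod_cast h), fun t ht => ?_⟩
    rw [hbcross]
    have := hall ⟨t, ht⟩
    simpa [Int.cast_natCast] using this
  · calc |θ - b| ≤ Real.logb 2 N + Δ := hb
      _ ≤ (m * (Nat.log 2 (m * K) + 1) : ℕ) + Δ := by
          have hc := card_rawTerm_le m K
          have h1 : (N : ℝ) ≤ (2 : ℝ) ^ (m * (Nat.log 2 (m * K) + 1)) := by rw [hN]; exact_mod_cast hc
          have h2 := Real.logb_le_logb_of_le (b := 2) (by norm_num) hNpos h1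
          rw [Real.logb_pow, Real.logb_self_eq_one (by norm_num), mul_one] at h2
          push_cast at h2 ⊢
          linarith
      _ = ((m * (Nat.log 2 (m * K) + 1) + Δ : ℕ) : ℝ) := by push_cast; ring


/-- The dyadic octave is the floor of `log₂|x|`. [folklore] -/
theorem octave_eq_floor (x : ℝ) : octave x = ⌊Real.logb 2 |x|⌋ := by
  have := Real.floor_logb_natCast (b := 2) (r := |x|) (abs_nonneg x)
  simp only [Nat.cast_ofNat] at this
  rw [octave, this]

open scoped Classical in
/-- **piece 3, PROVED** (unit-cell counting). [folklore] -/
theorem cellCount_proof : CellCount := by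
  intro p B W h
  unfold octaveCount
  set R := p.roots.toFinset.filter (fun x => x ≠ 0) with hR
  have hsub : R.image octave ⊆ B.biUnion (fun b => Finset.Icc (⌊b⌋ - W) (⌊b⌋ + W)) := by
    intro j hj
    obtain ⟨x, hx, rfl⟩ := Finset.mem_image.1 hj
    rw [hR, Finset.mem_filter, Multiset.mem_toFinset] at hx
    obtain ⟨hxr, hx0⟩ := hx
    have hroot : p.IsRoot x := (Polynomial.mem_roots'.1 hxr).2
    obtain ⟨b, hbB, hb⟩ := h x hx0 (Polynomial.mem_roots'.1 hxr).1 hroot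
    rw [Finset.mem_biUnion]
    refine ⟨b, hbB, ?_⟩
    rw [Finset.mem_Icc, octave_eq_floor]
    rw [abs_le] at hb
    constructor
    · have h1 : (⌊b⌋ : ℝ) - W ≤ Real.logb 2 |x| := by
        have := Int.floor_le b
        linarith
      have h2 : ((⌊b⌋ - (W : ℤ) : ℤ) : ℝ) ≤ Real.logb 2 |x| := by push_cast; exact h1
      exact Int.le_floor.2 h2
    · have h1 : Real.logb 2 |x| < (⌊b⌋ : ℝ) + 1 + W := by
        have := Int.lt_floor_add_one b
        linarith
      have h2 : Real.logb 2 |x| < (((⌊b⌋ + (W : ℤ) + 1 : ℤ)) : ℝ) := by push_cast; linarith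
      have := Int.floor_lt.2 h2
      omega
  calc (R.image octave).card ≤ (B.biUnion (fun b => Finset.Icc (⌊b⌋ - W) (⌊b⌋ + W))).card := Finset.card_le_card hsub
    _ ≤ ∑ b ∈ B, (Finset.Icc (⌊b⌋ - (W : ℤ)) (⌊b⌋ + W)).card := Finset.card_biUnion_le
    _ = ∑ _b ∈ B, (2 * W + 1) := Finset.sum_congr rfl fun b _ => by
        rw [Int.card_Icc]; omega
    _ = (2 * W + 1) * B.card := by rw [Finset.sum_const, smul_eq_mul, mul_comm]
    _ ≤ (2 * W + 2) * B.card := Nat.mul_le_mul_right _ (by omega)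

/-- **the rung** `ShallowOctaveLifting`, PROVED: assembled from its three proved pieces. -/
theorem shallowOctaveLifting_proof : ShallowOctaveLifting :=
  shallowOctaveLifting_of designPiecesBound_proof rootNearBreakpoint_proof cellCount_proof

/-! ### Next rung candidate (typed, NOT asserted): dead slope classes -/

/-- **live depth ≤ Δ**: the cancellation-depth condition imposed only on LIVE slope classes (nonzero coefficient); classes whose raw
Leibniz terms cancel EXACTLY (dead classes, e.g. from a group of rank-one letters `H·v vᵀ`) are unconstrained. [definition of the seat] -/
def LiveDepthLE {m K : ℕ} (d : Fin K → ℕ) (S : Fin K → Matrix (Fin m) (Fin m) ℝ) (Δ : ℕ) : Prop :=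
  ∀ e : ℕ, (pencilDet d S).coeff e ≠ 0 →
    (∑ σ : Equiv.Perm (Fin m), ∑ lam : Fin m → Fin K,
      (if (∑ i, d (lam i)) = e then ∏ i, |S (lam i) (σ i) i| else 0)) ≤ (2 : ℝ) ^ Δ * |(pencilDet d S).coeff e|

theorem liveDepthLE_of_depthLE {m K : ℕ} (d : Fin K → ℕ) (S : Fin K → Matrix (Fin m) (Fin m) ℝ) (Δ : ℕ)
    (h : DepthLE d S Δ) : LiveDepthLE d S Δ := fun e _ => h e

/-- **Dead-class octave lifting** (NEXT RUNG CANDIDATE toward `OctaveWeakLifting`; OPEN, not asserted): the conclusion of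
`ShallowOctaveLifting` under the weaker hypothesis `LiveDepthLE`.  Why it might fail / why the v4 method does not reach it: a DEAD ROOF —
a group of rank-one letters `H·v vᵀ` (all their pure classes dead, by the matrix determinant lemma `det(u v vᵀ + T) = det T + u·vᵀadj(T)v`)
owns the archimedean design envelope for `H → ∞` while the live classes stay shallow, so real root scales need not be near DESIGN
breakpoints (`rootNearBreakpoint` fails); a proof must see through the roof (quotient by the dead structure).  The BOUND itself survived the
rank-one family on paper (Ω ≈ K₂ − 1 ≤ n + 1 there). [candidate of the seat] -/
def DeadClassOctaveLifting : Prop :=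
  ∀ (m K n Δ : ℕ), Summit.ValiantsHypothesis.ValiantsHypothesis.Theorems.KPlusLogSqLaw.TropRowD m K n →
    ∀ (d : Fin K → ℕ) (S : Fin K → Matrix (Fin m) (Fin m) ℝ), LiveDepthLE d S Δ →
      octaveCount (pencilDet d S) ≤ (2 * (m * (Nat.log 2 (m * K) + 1) + Δ) + 3) * (n + 1)

/-- the candidate implies the proved rung (sanity of the typing). [folklore] -/
theorem shallowOctaveLifting_of_deadClass (h : DeadClassOctaveLifting) : ShallowOctaveLifting :=
  fun m K n Δ hT d S hΔ => h m K n Δ hT d S (liveDepthLE_of_depthLE d S Δ hΔ)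

end Depth

end Summit.ValiantsHypothesis.ValiantsHypothesis.Theses.KPlusLogSqLaw.OctaveLine
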